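import Literature.NumberTheory.Sieve.HeathBrownCubicPrimeTuples
import Literature.NumberTheory.Sieve.HeathBrownCubicLeadingParts
import Literature.NumberTheory.Sieve.HeathBrownCubicHatCore
import Literature.NumberTheory.Sieve.HeathBrownCubicUpperBoundTools
import Literature.NumberTheory.Sieve.HeathBrownCubicApproxUA
import Literature.NumberTheory.Sieve.HeathBrownCubicTypeIIReduction
import HarnessLib

/-!
# Heath-Brown's (10.5): `U(ℬ) = 3ηX³Σ₃ + O(η²M⁻¹X³)` — the `ℬ`-side of Lemma 3.9, proved

Pure-proof file (no definitions) in the decomposition of **parity.S18**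
(`Literature.NumberTheory.Sieve.setOf_prime_cube_add_two_mul_cube_infinite`) along D. R. Heath-Brown,
*Primes represented by `x³ + 2y³`*, Acta Math. 186 (2001), 1–84. `HeathBrownCubicLeadingParts` proved
`HeathBrown2001_lemma_3_9_of_displays`: the named fact `HeathBrown2001_lemma_3_9` (Lemma 3.9, the leading
parts) follows from the two displays of its proof (§10), (10.4) for `U_e(𝒜)` and (10.5) for `U(ℬ)`. This file
PROVES **(10.5)** (p. 65, and p. 66 for `n = 0`):

  `U(ℬ) = ∑_R c_R ∑_{RS ∈ ℬ^(K)} d_S = 3ηX³Σ₃ + O(η²M⁻¹X³)`,  `Σ₃ = ∑_R c_R w'(3X³/N(R))/(M(ξ log X)^{n+1}N(R))`,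

for every bilinear sum (3.3) over `ℬ^(K)` with the weight `d_S(𝐦)` — `HeathBrown2001_display_10_5`, the
hypothesis `h5` of `HeathBrown2001_lemma_3_9_of_displays` verbatim — so that Lemma 3.9 now rests on (10.4) alone
(`HeathBrown2001_lemma_3_9_of_display_10_4`; (10.4) needs the Type I bound Lemma 3.2,
`HeathBrown2001_typeI_A`, an unproved named fact of `HeathBrownCubicSieveSetup`, together with (10.1)–(10.2) and
the evaluation of `Σ₁` by Perron's formula, pp. 60–64).

## The argument (pp. 64–66) and its rendering

* `U(ℬ) = ∑_R c_R (M(ξ log X)^{n+1})⁻¹ Σ_R`, `Σ_R = ∑_{P_i ∈ 𝒥(m_i), 3X³/N(R) < ∏N(P_i) ≤ 3X³(1+η)/N(R)} ∏ log N(P_i)`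
  ("We begin by considering `∑_{S ∈ ℬ(R;K)} d_S = …`", p. 64) — `bilin_normWindow_dWeight_eq`, from
  `bilin_dWeight_eq_sum_tuples` (`HeathBrownCubicHatCore`) and the count `hatCount_normWindow_eq`;
  `Σ_R = T(Y_R(1+η)) − T(Y_R)`, `Y_R = 3X³/N(R)`, `T(Z) = ∑_{∏N(P_i) ≤ Z} ∏ log N(P_i)` (`windowTupleSum_eq_sub`);
  and `3ηX³Σ₃ = ∑_R c_R (M(ξ log X)^{n+1})⁻¹ ηY_R w'(Y_R)` over the same `R` (`sigma3_eq_sum_large`), whence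
  `|U(ℬ) − 3ηX³Σ₃| ≤ ∑_{R ≠ 0} (M(ξ log X)^{n+1})⁻¹ |T(Y_R(1+η)) − T(Y_R) − ηY_R w'(Y_R)|` (`abs_bilinB_sub_main_le`).
* Lemma 4.10 ("We now apply Lemma 4.10 … we may take `ϱ = X^ξ` and `Δ = L`", p. 64; PROVED in
  `HeathBrownCubicPrimeTuples` as `primeTuples_sub_wMeas_le`): `|T(Z) − w(Z, 𝐦)| ≤ AZ`,
  `A = C₄(n+1)(c₁ + ξ log X)^n exp(−c₂√(τ log X))`.
* `n ≥ 1`: the mean value theorem and (8.3) (`abs_wMeas_sub_sub_mul_wDeriv_le` of `HeathBrownCubicWCalculus`):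
  `|w(Y(1+η)) − w(Y) − ηYw'(Y)| ≤ 2η²Y(ξ log X)^{n−1}` — `abs_windowDiff_sub_le_of_two`;
  `n = 0`: `w'` is the indicator of `J(m_1)` and the comparison is exact unless an endpoint of `J(m_1)` lies in
  `(Y, Y(1+η)]`, where it is off by `≤ ηY` — `abs_windowDiff_sub_le_of_one`.
* Summation over `R` (`abs_bilinB_sub_main_le_of_perR`): `∑_{0 < N(R) ≤ 6X³} 1/N(R) ≪ log X`
  (`exists_sum_inv_absNorm_idealsLE_le`, dyadic blocks and the ideal count `I_K(t) ≤ At`), so the Lemma-4.10 errors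
  total `≪ M⁻¹X³(log X)exp(−c₂√(τ log X))·(n+1)(1 + c₁/(ξ log X))^n/(ξ log X) ≪ M⁻¹η²X³` (`term1_le`; (9.5) is
  `add_pow_le_exp_mul_pow`, and `exp(−c₂√(τ log X)) log X ≤ exp(−2(log X)^{1/3}) ≤ η²`); for `n ≥ 1` the mean-value
  errors total `6η²X³(∑1/N(R))/(M(ξ log X)²) ≤ M⁻¹η²X³`; for `n = 0` the exceptional `R` have
  `3X³/E < N(R) ≤ (3X³/E)(1+η)` for an endpoint `E`, and Weber's count `I_K(t) = γ₀t + O(t^{2/3})` (Lemma 4.1, PROVED in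
  the tree as `…idealCount_sub_residue_mul_le_holds`) gives `∑ 1/N(R) ≤ γ₀η + C_w(3X³/E)^{−1/3} ≤ (γ₀ + C_w)η`
  (`exists_sum_inv_absNorm_window_le`, `sum_exceptional_le_eta`), total `≤ 6(γ₀ + C_w)M⁻¹η²X³`.
* The inequalities "for `X` large" are collected in `eventually_leadingB_params` (from
  `eventually_hbTau_pow_mul_log`, `eventually_loglog_rpow_le` of the earlier layers).

Constants: the final `C = 2 + 6(γ₀ + C_w)` depends on `K` only (`γ₀`, the Weber constant) — in particular not on
`ϖ`; `X₀` depends on `ϖ` and on the Lemma-4.10 and counting constants.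

## References

* D. R. Heath-Brown, *Primes represented by `x³ + 2y³`*, Acta Math. 186 (2001), 1–84: §10 pp. 64–66
  ((10.5), the case `n = 0`), Lemma 4.1 (p. 22), Lemma 4.10 (p. 27), (9.5) (p. 55), (2.1), (2.5).
  [cite: HeathBrownActa2001, §10 (10.5)]

## Mathlib / tree search

Tree: `HeathBrownCubicPrimeTuples` (`primeTuples_sub_wMeas_le`), `HeathBrownCubicWCalculus`
(`abs_wMeas_sub_sub_mul_wDeriv_le`, `abs_wMeas_sub_sub_mul_wDeriv_le_of_one`, `wMeas_sub_wMeas_eq_mul_wDeriv_of_one`),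
`HeathBrownCubicLeadingParts` (`sigma3`, `sigma3_summand_eq_zero`, `HeathBrown2001_lemma_3_9_of_displays`),
`HeathBrownCubicHatCore` (`bilin_dWeight_eq_sum_tuples`), `HeathBrownCubicUpperBoundTools` (`card_idealsLE_eq`),
`HeathBrownCubicApproxUA` (`eventually_hbTau_pow_mul_log`), `HeathBrownCubicTypeIIReduction`
(`eventually_loglog_rpow_le`), `HeathBrownCubicTypeII` (`bilin`, `dWeight`, `Jprimes`, `CoreAdmissible`,
`CSupport`, `rpow_bounds_of_coreAdmissible`, `card_mul_lt_of_coreAdmissible`, `one_le_prod_of_coreAdmissible`,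
`length_pos_of_coreAdmissible`, `mem_divisorPairs_iff`), `HeathBrownCubicSieveSetup` (`idealsLE`, `normWindow`,
`gamma₀`), `HeathBrownCubicSieveDecomposition` (`hbTau`, `ne_bot_of_mem_normWindow`),
`LFunctions/IdealCountProofs` (`idealCount_sub_residue_mul_le_holds`). Mathlib: `Finset.sum_bij`,
`Finset.sum_fiberwise_of_maps_to`, `Nat.log`, `Nat.pow_log_le_self`, `Nat.lt_pow_succ_log_self`,
`Finset.card_sdiff_of_subset`, `Real.rpow_le_rpow_of_nonpos`, `Real.add_one_le_exp`, `Real.log_le_rpow_div`,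
`Real.exp_one_lt_d9`, `Real.exp_one_gt_d9`, `Real.log_two_lt_d9`.
-/

noncomputable section

open MeasureTheory Set Filter Topology Finset NumberField
open scoped ENNReal

namespace Literature.NumberTheory.Sieve.CubicSieve

open LFunctions.CubeRootTwoField CubicPrimes

/-! ### `U(ℬ)` as a sum over `R` of prime-tuple sums (p. 64) -/

section Combinatorics

variable {X η τ : ℝ}

/-- The hat-side count for `ℬ^(K)` (the coefficient of `d_S` in `U(ℬ) = ∑_R c_R ∑_{RS ∈ ℬ^(K)} d_S`): for
`X ≥ 0` and any ideal `S`, `∑_{J ∈ ℬ^(K)} ∑_{(R,S') : RS' = J, S' = S} c_R = ∑_{R : N(R) ≤ 3X³(1+η)} [R·S ∈ ℬ^(K)] c_R`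
(pairs `(R, S)` with `RS = J` correspond to the `R` with `R·S = J`). [cite: HeathBrownActa2001, §10 p. 64] -/
theorem hatCount_normWindow_eq (hX : 0 ≤ X) (c : Ideal (𝓞 K) → ℝ) (S : Ideal (𝓞 K)) :
    (∑ J ∈ normWindow X η, ∑ RS ∈ divisorPairs J, if S = RS.2 then c RS.1 else 0) =
      ∑ R ∈ idealsLE ⌊3 * X ^ 3 * (1 + η)⌋₊, if R * S ∈ normWindow X η then c R else 0 := by
  classical
  -- for each member `J`, the pairs `(R, S)` with `RS = J` correspond to the `R` with `R * S = J`
  have hJ : ∀ J ∈ normWindow X η, (∑ RS ∈ divisorPairs J, if S = RS.2 then c RS.1 else 0) =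
      ∑ R ∈ idealsLE ⌊3 * X ^ 3 * (1 + η)⌋₊, if R * S = J then c R else 0 := by
    intro J hJw
    have hJ0 : J ≠ ⊥ := ne_bot_of_mem_normWindow hX J hJw
    have hJle : (Ideal.absNorm J : ℝ) ≤ 3 * X ^ 3 * (1 + η) := (mem_normWindow_iff.mp hJw).2
    rw [← sum_filter, ← sum_filter]
    refine Finset.sum_bij (fun RS _ => RS.1) (fun RS hRS => ?_) (fun RS₁ h₁ RS₂ h₂ heq => ?_)
      (fun R hR => ?_) (fun RS _ => rfl)
    · obtain ⟨hRS, hS2⟩ := mem_filter.mp hRS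
      have hmul : RS.1 * RS.2 = J := (mem_divisorPairs_iff hJ0).mp hRS
      refine mem_filter.mpr ⟨mem_idealsLE.mpr (Nat.le_floor ?_), by rw [hS2, hmul]⟩
      have h1 : Ideal.absNorm RS.1 ∣ Ideal.absNorm J := by
        rw [← hmul, map_mul]; exact dvd_mul_right _ _
      have h2 : (Ideal.absNorm RS.1 : ℝ) ≤ Ideal.absNorm J := by
        exact_mod_cast Nat.le_of_dvd (Nat.pos_of_ne_zero fun h => hJ0 (Ideal.absNorm_eq_zero_iff.mp h)) h1
      exact h2.trans hJle
    · obtain ⟨hRS₁, hS₁⟩ := mem_filter.mp h₁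
      obtain ⟨hRS₂, hS₂⟩ := mem_filter.mp h₂
      exact Prod.ext heq (by rw [← hS₁, ← hS₂])
    · obtain ⟨-, hRJ⟩ := mem_filter.mp hR
      exact ⟨(R, S), mem_filter.mpr ⟨(mem_divisorPairs_iff hJ0).mpr hRJ, rfl⟩, rfl⟩
  rw [sum_congr rfl hJ, sum_comm]
  refine sum_congr rfl fun R _ => ?_
  rw [Finset.sum_ite_eq (normWindow X η) (R * S) (fun _ => c R)]

/-- `N(R·∏P_i) = N(R) ∏ N(P_i)` (as reals). [folklore] -/
theorem absNorm_mul_prod_cast {k : ℕ} (R : Ideal (𝓞 K)) (P : Fin k → Ideal (𝓞 K)) :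
    (Ideal.absNorm (R * ∏ i, P i) : ℝ) = (Ideal.absNorm R : ℝ) * ∏ i, (Ideal.absNorm (P i) : ℝ) := by
  rw [map_mul, map_prod, Nat.cast_mul, Nat.cast_prod]

/-- **`U(ℬ) = ∑_R c_R (M(ξ log X)^{n+1})⁻¹ Σ_R`** (p. 64: "We turn now to the analysis of `U(ℬ)`. We begin by
considering `∑_{S ∈ ℬ(R;K)} d_S = M⁻¹(ξ log X)^{−n−1} ∑_{P_1,…,P_{n+1}} ∏ log N(P_i)`, where `N(P_i) ∈ J(m_i)` and
`3X³/N(R) < ∏ N(P_i) ≤ 3X³(1+η)/N(R)`"): the bilinear sum (3.3) over `ℬ^(K)` with the weight `d_S(𝐦)` is the sum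
over the ideals `R` of norm `≤ 3X³(1+η)` of `c_R (∏ m_iξ log X)⁻¹ Σ_R`, `Σ_R` the sum of `∏ log N(P_i)` over the
tuples of first-degree primes `P_i ∈ 𝒥(m_i)` with `3X³ < N(R)∏N(P_i) ≤ 3X³(1+η)` (`X > 0`).
[cite: HeathBrownActa2001, §10 p. 64] -/
theorem bilin_normWindow_dWeight_eq (hX : 0 < X) (c : Ideal (𝓞 K) → ℝ) {k : ℕ}
    (m : Fin k → ℕ) :
    bilin (normWindow X η) (fun J => J) c (dWeight X τ m) =
      ∑ R ∈ idealsLE ⌊3 * X ^ 3 * (1 + η)⌋₊, c R * ((∏ i, ((m i : ℝ) * hbXi τ * Real.log X))⁻¹ *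
        ∑ P ∈ Fintype.piFinset (fun i => Jprimes X τ (m i)),
          if 3 * X ^ 3 < (Ideal.absNorm R : ℝ) * ∏ i, (Ideal.absNorm (P i) : ℝ) ∧
              (Ideal.absNorm R : ℝ) * ∏ i, (Ideal.absNorm (P i) : ℝ) ≤ 3 * X ^ 3 * (1 + η)
            then ∏ i, Real.log (Ideal.absNorm (P i)) else 0) := by
  classical
  rw [bilin_dWeight_eq_sum_tuples]
  -- the hat-count is a sum over `R`
  have hstep : ∀ P ∈ Fintype.piFinset (fun i => Jprimes X τ (m i)),
      (∑ J ∈ normWindow X η, ∑ RS ∈ divisorPairs J, if ∏ j, P j = RS.2 then c RS.1 else 0) =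
        ∑ R ∈ idealsLE ⌊3 * X ^ 3 * (1 + η)⌋₊,
          if 3 * X ^ 3 < (Ideal.absNorm R : ℝ) * ∏ i, (Ideal.absNorm (P i) : ℝ) ∧
              (Ideal.absNorm R : ℝ) * ∏ i, (Ideal.absNorm (P i) : ℝ) ≤ 3 * X ^ 3 * (1 + η)
            then c R else 0 := by
    intro P hP
    rw [hatCount_normWindow_eq hX.le c]
    refine sum_congr rfl fun R _ => ?_
    have hiff : R * ∏ j, P j ∈ normWindow X η ↔
        3 * X ^ 3 < (Ideal.absNorm R : ℝ) * ∏ i, (Ideal.absNorm (P i) : ℝ) ∧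
          (Ideal.absNorm R : ℝ) * ∏ i, (Ideal.absNorm (P i) : ℝ) ≤ 3 * X ^ 3 * (1 + η) := by
      rw [mem_normWindow_iff, absNorm_mul_prod_cast]
    exact if_congr hiff rfl rfl
  rw [sum_congr rfl fun P hP => by rw [hstep P hP]]
  -- swap the sums and factor
  simp_rw [mul_sum]
  rw [sum_comm]
  refine sum_congr rfl fun R _ => sum_congr rfl fun P _ => ?_
  rw [prod_div_distrib]
  split_ifs <;> ring

/-- For `N = N(R) > 0` the window condition `3X³ < N·Π ≤ 3X³(1+η)` reads `Y_R < Π ≤ Y_R(1+η)`, `Y_R = 3X³/N`,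
so the tuple sum `Σ_R` is the difference of the two sums with the upper constraints `Π ≤ Y_R(1+η)` and `Π ≤ Y_R`
(the shape of Lemma 4.10). [cite: HeathBrownActa2001, §10 p. 64] -/
theorem windowTupleSum_eq_sub {X η : ℝ} (hX : 0 ≤ X) (hη : 0 ≤ η) {k : ℕ}
    (F : Fin k → Finset (Ideal (𝓞 K))) {N : ℝ} (hN : 0 < N) :
    (∑ P ∈ Fintype.piFinset F,
        if 3 * X ^ 3 < N * ∏ i, (Ideal.absNorm (P i) : ℝ) ∧
            N * ∏ i, (Ideal.absNorm (P i) : ℝ) ≤ 3 * X ^ 3 * (1 + η)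
          then ∏ i, Real.log (Ideal.absNorm (P i)) else 0) =
      (∑ P ∈ Fintype.piFinset F,
          if ∏ i, (Ideal.absNorm (P i) : ℝ) ≤ 3 * X ^ 3 / N * (1 + η)
            then ∏ i, Real.log (Ideal.absNorm (P i)) else 0) -
        ∑ P ∈ Fintype.piFinset F,
          if ∏ i, (Ideal.absNorm (P i) : ℝ) ≤ 3 * X ^ 3 / N then ∏ i, Real.log (Ideal.absNorm (P i)) else 0 := by
  rw [← sum_sub_distrib]
  refine sum_congr rfl fun P _ => ?_
  set Nm : ℝ := ∏ i, (Ideal.absNorm (P i) : ℝ) with hNm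
  have h1 : 3 * X ^ 3 < N * Nm ↔ ¬ Nm ≤ 3 * X ^ 3 / N := by
    rw [not_le, div_lt_iff₀ hN, mul_comm Nm N]
  have h2 : N * Nm ≤ 3 * X ^ 3 * (1 + η) ↔ Nm ≤ 3 * X ^ 3 / N * (1 + η) := by
    rw [div_mul_eq_mul_div, le_div_iff₀ hN, mul_comm Nm N]
  have h12 : Nm ≤ 3 * X ^ 3 / N → Nm ≤ 3 * X ^ 3 / N * (1 + η) := fun h =>
    h.trans (le_mul_of_one_le_right (by positivity : (0:ℝ) ≤ 3 * X ^ 3 / N ) (by linarith))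
  by_cases hA : Nm ≤ 3 * X ^ 3 / N
  · rw [if_neg (fun h => (h1.mp h.1) hA), if_pos (h12 hA), if_pos hA, sub_self]
  · by_cases hB : Nm ≤ 3 * X ^ 3 / N * (1 + η)
    · rw [if_pos ⟨h1.mpr hA, h2.mpr hB⟩, if_pos hB, if_neg hA, sub_zero]
    · rw [if_neg (fun h => hB (h2.mp h.2)), if_neg hB, if_neg hA, sub_zero]

/-- **`Σ₃` over the larger range**: for `X ≥ 1`, `τ > 0`, `η ≥ 0`,
`Σ₃ = ∑_{N(R) ≤ 3X³(1+η)} c_R w'(3X³/N(R))/(M(ξ log X)^{n+1}N(R))` — the added `R` (of norm `> 3X³`) contribute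
nothing (`sigma3_summand_eq_zero`). [cite: HeathBrownActa2001, §10 p. 64] -/
theorem sigma3_eq_sum_large (hX : 1 ≤ X) (hτ : 0 < τ) (hη : 0 ≤ η) {k : ℕ} (m : Fin k → ℕ)
    (c : Ideal (𝓞 K) → ℝ) :
    sigma3 X τ m c = ∑ R ∈ idealsLE ⌊3 * X ^ 3 * (1 + η)⌋₊,
      c R * wDeriv X τ m (3 * X ^ 3 / Ideal.absNorm R) /
        ((∏ i, ((m i : ℝ) * hbXi τ * Real.log X)) * Ideal.absNorm R) := by
  classical
  unfold sigma3
  have hsub : idealsLE ⌊3 * X ^ 3⌋₊ ⊆ idealsLE ⌊3 * X ^ 3 * (1 + η)⌋₊ := by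
    intro R hR
    rw [mem_idealsLE] at hR ⊢
    refine hR.trans (Nat.floor_le_floor ?_)
    exact le_mul_of_one_le_right (by positivity) (by linarith)
  refine sum_subset hsub fun R hR hRnot => ?_
  rw [mem_idealsLE, not_le] at hRnot
  have hgt : 3 * X ^ 3 < (Ideal.absNorm R : ℝ) := by
    have h1 : (⌊3 * X ^ 3⌋₊ : ℝ) + 1 ≤ Ideal.absNorm R := by exact_mod_cast hRnot
    linarith [Nat.lt_floor_add_one (3 * X ^ 3)]
  exact sigma3_summand_eq_zero hX hτ m c hgt

end Combinatorics

/-! ### The per-`R` comparison with the leading term (pp. 64–66) -/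

section PerR

variable {X τ : ℝ}

/-- **The case `n ≥ 1` of the per-`R` comparison** (p. 65: "When `n ≥ 1` the Mean Value Theorem shows that
`w(3X³(1+η)/N(R)) − w(3X³/N(R)) = (3ηX³/N(R)) w'(λ)` … We may then use (8.3)"): for `𝐦` of length `n + 2`, if
`|T(Z) − w(Z, 𝐦)| ≤ AZ` for `Z > 0` (Lemma 4.10), then for `Y > 0` and `0 ≤ η ≤ 1`,
`|T(Y(1+η)) − T(Y) − ηY w'(Y)| ≤ 3AY + 2η²Y(ξ log X)^n` (`abs_wMeas_sub_sub_mul_wDeriv_le`).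
[cite: HeathBrownActa2001, §10 p. 65] -/
theorem abs_windowDiff_sub_le_of_two (hX : 1 ≤ X) (hτ : 0 ≤ τ) {n : ℕ} (m : Fin (n + 2) → ℕ)
    {T : ℝ → ℝ} {A : ℝ} (hT : ∀ Z, 0 < Z → |T Z - wMeas X τ m Z| ≤ A * Z)
    {Y η : ℝ} (hY : 0 < Y) (hη0 : 0 ≤ η) (hη1 : η ≤ 1) :
    |T (Y * (1 + η)) - T Y - η * Y * wDeriv X τ m Y| ≤
      3 * A * Y + 2 * η ^ 2 * Y * (hbXi τ * Real.log X) ^ n := by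
  have hA : 0 ≤ A := by have := (abs_nonneg _).trans (hT 1 one_pos); linarith
  have hY' : 0 < Y * (1 + η) := by positivity
  have hYY' : Y ≤ Y * (1 + η) := le_mul_of_one_le_right hY.le (by linarith)
  have h1 := hT _ hY'
  have h2 := hT _ hY
  have h3 := abs_wMeas_sub_sub_mul_wDeriv_le hX hτ m hY hYY'
  have hmv : 2 * ((Y * (1 + η) - Y) ^ 2 / Y) * (hbXi τ * Real.log X) ^ n =
      2 * η ^ 2 * Y * (hbXi τ * Real.log X) ^ n := by
    field_simp
    ring
  rw [hmv] at h3
  have hsplit : T (Y * (1 + η)) - T Y - η * Y * wDeriv X τ m Y =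
      (T (Y * (1 + η)) - wMeas X τ m (Y * (1 + η))) - (T Y - wMeas X τ m Y) +
        (wMeas X τ m (Y * (1 + η)) - wMeas X τ m Y - (Y * (1 + η) - Y) * wDeriv X τ m Y) := by ring
  rw [hsplit]
  refine (abs_add_le _ _).trans ?_
  refine (add_le_add ((abs_sub _ _).trans (add_le_add h1 h2)) h3).trans ?_
  nlinarith [mul_nonneg hA hY.le]

/-- **The case `n = 0` of the per-`R` comparison** (pp. 65–66: "When `n = 0` we recall that `w'(t)` is the
characteristic function of `J(m_1)`. A little thought then reveals that
`w(3X³(1+η)/N(R)) − w(3X³/N(R)) = (3ηX³/N(R)) w'(3X³/N(R))` unless one of the endpoints of `J(m_1)` lies in the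
interval between `3X³/N(R)` and `3X³(1+η)/N(R)`. In the latter case we have `|…| ≤ 3ηX³/N(R)`"): for `𝐦 = (m_1)` and
`T` as above, `|T(Y(1+η)) − T(Y) − ηY w'(Y)| ≤ 3AY + ηY·[an endpoint of J(m_1) lies in (Y, Y(1+η)]]`.
[cite: HeathBrownActa2001, §10 pp. 65–66] -/
theorem abs_windowDiff_sub_le_of_one (hX : 1 ≤ X) (hτ : 0 ≤ τ) (m : Fin 1 → ℕ)
    {T : ℝ → ℝ} {A : ℝ} (hT : ∀ Z, 0 < Z → |T Z - wMeas X τ m Z| ≤ A * Z)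
    {Y η : ℝ} (hY : 0 < Y) (hη0 : 0 ≤ η) (hη1 : η ≤ 1) :
    |T (Y * (1 + η)) - T Y - η * Y * wDeriv X τ m Y| ≤
      3 * A * Y + (if X ^ ((m 0 : ℝ) * hbXi τ) ∈ Set.Ioc Y (Y * (1 + η)) ∨
          X ^ (((m 0 : ℝ) + 1) * hbXi τ) ∈ Set.Ioc Y (Y * (1 + η)) then η * Y else 0) := by
  have hA : 0 ≤ A := by have := (abs_nonneg _).trans (hT 1 one_pos); linarith
  have hY' : 0 < Y * (1 + η) := by positivity
  have hYY' : Y ≤ Y * (1 + η) := le_mul_of_one_le_right hY.le (by linarith)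
  have h1 := hT _ hY'
  have h2 := hT _ hY
  have hsplit : T (Y * (1 + η)) - T Y - η * Y * wDeriv X τ m Y =
      (T (Y * (1 + η)) - wMeas X τ m (Y * (1 + η))) - (T Y - wMeas X τ m Y) +
        (wMeas X τ m (Y * (1 + η)) - wMeas X τ m Y - (Y * (1 + η) - Y) * wDeriv X τ m Y) := by ring
  rw [hsplit]
  refine (abs_add_le _ _).trans ?_
  have h12 : |T (Y * (1 + η)) - wMeas X τ m (Y * (1 + η)) - (T Y - wMeas X τ m Y)| ≤ 3 * A * Y := by
    refine ((abs_sub _ _).trans (add_le_add h1 h2)).trans ?_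
    nlinarith [mul_nonneg hA hY.le]
  refine add_le_add h12 ?_
  split_ifs with hexc
  · have h3 := abs_wMeas_sub_sub_mul_wDeriv_le_of_one hX hτ m hYY'
    refine h3.trans (le_of_eq ?_)
    ring
  · rw [not_or] at hexc
    rw [wMeas_sub_wMeas_eq_mul_wDeriv_of_one hX hτ m hYY' hexc.1 hexc.2, sub_self, abs_zero]

end PerR

/-! ### Counting ideals: `∑_{N(R) ≤ N} 1/N(R) ≪ log N` and short norm windows (Weber) -/

section Counting

/-- **`I_K(t) ≤ A t`** for `t ≥ 1`: the ideal count of `K`, from the Weber–Landau estimate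
`I_K(t) = γ₀t + O(t^{2/3})` PROVED in the tree
(`Literature.NumberTheory.LFunctions.NumberField.idealCount_sub_residue_mul_le_holds`; Heath-Brown's
Lemma 4.1). [cite: HeathBrownActa2001, Lemma 4.1] -/
theorem exists_idealCount_le_mul :
    ∃ A : ℝ, 0 < A ∧ ∀ t : ℝ, 1 ≤ t →
      (Literature.NumberTheory.LFunctions.NumberField.idealCount K t : ℝ) ≤ A * t := by
  obtain ⟨C₀, hC₀⟩ := Literature.NumberTheory.LFunctions.NumberField.idealCount_sub_residue_mul_le_holds K
  set ρ : ℝ := NumberField.dedekindZeta_residue K with hρ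
  have hρ0 : 0 < ρ := NumberField.dedekindZeta_residue_pos K
  have hC₀0 : 0 ≤ C₀ := by
    have h := hC₀ 1 le_rfl
    simp only [Real.one_rpow, mul_one] at h
    exact (abs_nonneg _).trans h
  refine ⟨ρ + C₀ + 1, by positivity, fun t ht => ?_⟩
  have h := hC₀ t ht
  have ht0 : 0 < t := by linarith
  have hpow : t ^ (1 - 1 / (Module.finrank ℚ K : ℝ)) ≤ t := by
    calc t ^ (1 - 1 / (Module.finrank ℚ K : ℝ)) ≤ t ^ (1 : ℝ) := by
          refine Real.rpow_le_rpow_of_exponent_le ht ?_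
          have : (0 : ℝ) ≤ 1 / (Module.finrank ℚ K : ℝ) := by positivity
          linarith
      _ = t := Real.rpow_one t
  have h' := (abs_le.mp h).2
  nlinarith [mul_le_mul_of_nonneg_left hpow hC₀0]

/-- `#{R : N(R) ≤ N} ≤ A N` for `N ≥ 1` (the zero ideal included). [cite: HeathBrownActa2001, Lemma 4.1] -/
theorem exists_card_idealsLE_le_mul :
    ∃ A : ℝ, 0 < A ∧ ∀ N : ℕ, 1 ≤ N → (#(idealsLE N) : ℝ) ≤ A * N := by
  obtain ⟨A, hA, h⟩ := exists_idealCount_le_mul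
  refine ⟨A + 1, by positivity, fun N hN => ?_⟩
  rw [card_idealsLE_eq]
  have h1 := h N (by exact_mod_cast hN)
  have hN1 : (1 : ℝ) ≤ N := by exact_mod_cast hN
  nlinarith

/-- **The harmonic sum over ideals**: `∑_{0 < N(R) ≤ N} 1/N(R) ≤ C (1 + log N)` for `N ≥ 1` ("`Σ₃ ≪
(Mξ log X)⁻¹ ∑_R c_R/N(R) ≪ M⁻¹ log X`", p. 64) — dyadic blocks `2^j ≤ N(R) < 2^{j+1}`, each contributing
`≤ 2A + 1` by the ideal count. [cite: HeathBrownActa2001, §10 p. 64] -/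
theorem exists_sum_inv_absNorm_idealsLE_le :
    ∃ C : ℝ, 0 < C ∧ ∀ N : ℕ, 1 ≤ N →
      ∑ R ∈ (idealsLE N).filter (fun R => R ≠ ⊥), ((Ideal.absNorm R : ℕ) : ℝ)⁻¹ ≤ C * (1 + Real.log N) := by
  classical
  obtain ⟨A, hA, hcard⟩ := exists_card_idealsLE_le_mul
  refine ⟨(2 * A + 1) * 2, by positivity, fun N hN => ?_⟩
  set S := (idealsLE N).filter (fun R => R ≠ ⊥) with hS
  set J := Nat.log 2 N with hJ
  -- group by `j = log₂ N(R)`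
  have hmaps : ∀ R ∈ S, Nat.log 2 (Ideal.absNorm R) ∈ Finset.range (J + 1) := by
    intro R hR
    obtain ⟨hRN, -⟩ := mem_filter.mp hR
    rw [mem_idealsLE] at hRN
    exact Finset.mem_range.mpr (Nat.lt_succ_of_le (Nat.log_mono_right hRN))
  rw [← sum_fiberwise_of_maps_to hmaps]
  have hblock : ∀ j ∈ Finset.range (J + 1),
      ∑ R ∈ S.filter (fun R => Nat.log 2 (Ideal.absNorm R) = j), ((Ideal.absNorm R : ℕ) : ℝ)⁻¹ ≤ 2 * A + 1 := by
    intro j _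
    have hsub : S.filter (fun R => Nat.log 2 (Ideal.absNorm R) = j) ⊆ idealsLE (2 ^ (j + 1)) := by
      intro R hR
      obtain ⟨-, hj⟩ := mem_filter.mp hR
      rw [mem_idealsLE]
      have := Nat.lt_pow_succ_log_self one_lt_two (Ideal.absNorm R)
      rw [hj] at this
      exact this.le
    have hterm : ∀ R ∈ S.filter (fun R => Nat.log 2 (Ideal.absNorm R) = j),
        ((Ideal.absNorm R : ℕ) : ℝ)⁻¹ ≤ ((2 : ℝ) ^ j)⁻¹ := by
      intro R hR
      obtain ⟨hRS, hj⟩ := mem_filter.mp hR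
      obtain ⟨-, hR0⟩ := mem_filter.mp hRS
      have hN0 : Ideal.absNorm R ≠ 0 := fun h => hR0 (Ideal.absNorm_eq_zero_iff.mp h)
      have hle : 2 ^ j ≤ Ideal.absNorm R := by rw [← hj]; exact Nat.pow_log_le_self 2 hN0
      refine inv_anti₀ (by positivity) ?_
      exact_mod_cast hle
    calc ∑ R ∈ S.filter (fun R => Nat.log 2 (Ideal.absNorm R) = j), ((Ideal.absNorm R : ℕ) : ℝ)⁻¹
        ≤ ∑ R ∈ S.filter (fun R => Nat.log 2 (Ideal.absNorm R) = j), ((2 : ℝ) ^ j)⁻¹ := sum_le_sum hterm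
      _ = #(S.filter (fun R => Nat.log 2 (Ideal.absNorm R) = j)) * ((2 : ℝ) ^ j)⁻¹ := by
          rw [sum_const, nsmul_eq_mul]
      _ ≤ #(idealsLE (2 ^ (j + 1))) * ((2 : ℝ) ^ j)⁻¹ := by
          gcongr
      _ ≤ A * (2 ^ (j + 1) : ℕ) * ((2 : ℝ) ^ j)⁻¹ := by
          gcongr
          exact hcard _ (Nat.one_le_two_pow)
      _ = 2 * A := by push_cast; field_simp; ring
      _ ≤ 2 * A + 1 := by linarith
  calc ∑ j ∈ Finset.range (J + 1), ∑ R ∈ S.filter (fun R => Nat.log 2 (Ideal.absNorm R) = j),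
        ((Ideal.absNorm R : ℕ) : ℝ)⁻¹
      ≤ ∑ _j ∈ Finset.range (J + 1), (2 * A + 1) := sum_le_sum hblock
    _ = (J + 1) * (2 * A + 1) := by rw [sum_const, card_range, nsmul_eq_mul]; push_cast; ring
    _ ≤ (2 * A + 1) * 2 * (1 + Real.log N) := by
        have hJle : (J : ℝ) ≤ Real.log N / Real.log 2 := by
          rw [le_div_iff₀ (Real.log_pos one_lt_two), ← Real.log_pow]
          refine Real.log_le_log (by positivity) ?_
          exact_mod_cast Nat.pow_log_le_self 2 (by omega : N ≠ 0)
        have hl2 : (1 : ℝ) / 2 < Real.log 2 := by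
          have := Real.log_two_gt_d9; linarith
        have hlogN : 0 ≤ Real.log N := Real.log_nonneg (by exact_mod_cast hN)
        have hJle' : (J : ℝ) ≤ 2 * Real.log N := by
          calc (J : ℝ) ≤ Real.log N / Real.log 2 := hJle
            _ ≤ Real.log N / (1 / 2) := div_le_div_of_nonneg_left hlogN (by norm_num) hl2.le
            _ = 2 * Real.log N := by ring
        nlinarith

/-- **Short norm windows (Weber)** (p. 66: "We deduce from Lemma 4.1 that the corresponding sum is `O(η)`"):
for `A ≥ 1`, `0 ≤ η ≤ 1`, `∑_{A < N(R) ≤ A(1+η)} 1/N(R) ≤ γ₀η + C_w A^{−1/3}`, `γ₀` the residue of `ζ_K` at `1`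
(`gamma₀`), from `I_K(t) = γ₀t + O(t^{2/3})`. [cite: HeathBrownActa2001, Lemma 4.1] -/
theorem exists_sum_inv_absNorm_window_le :
    ∃ Cw : ℝ, 0 < Cw ∧ ∀ A η : ℝ, 1 ≤ A → 0 ≤ η → η ≤ 1 →
      ∑ R ∈ (idealsLE ⌊A * (1 + η)⌋₊).filter (fun R => A < (Ideal.absNorm R : ℝ)),
        ((Ideal.absNorm R : ℕ) : ℝ)⁻¹ ≤ gamma₀ * η + Cw * A ^ (-(1 / 3 : ℝ)) := by
  classical
  obtain ⟨C₀, hC₀⟩ := Literature.NumberTheory.LFunctions.NumberField.idealCount_sub_residue_mul_le_holds K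
  have hρ0 : 0 < gamma₀ := gamma₀_pos
  have hC₀0 : 0 ≤ C₀ := by
    have h := hC₀ 1 le_rfl
    simp only [Real.one_rpow, mul_one] at h
    exact (abs_nonneg _).trans h
  have hexp : (1 - 1 / (Module.finrank ℚ K : ℝ)) = 2 / 3 := by rw [finrank_K]; norm_num
  -- `I_K` at the two ends
  refine ⟨2 * gamma₀ + 3 * C₀ + 1, by positivity, fun A η hA hη0 hη1 => ?_⟩
  set B : ℝ := A * (1 + η) with hB
  have hAB : A ≤ B := le_mul_of_one_le_right (by linarith) (by linarith)
  have hB2 : B ≤ 2 * A := by rw [hB]; nlinarith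
  have hA0 : 0 < A := by linarith
  set I := Literature.NumberTheory.LFunctions.NumberField.idealCount K with hI
  -- the window count
  have hcount : (#((idealsLE ⌊B⌋₊).filter (fun R => A < (Ideal.absNorm R : ℝ))) : ℝ) ≤
      gamma₀ * η * A + gamma₀ + 3 * C₀ * A ^ (2 / 3 : ℝ) := by
    have hsplit : (idealsLE ⌊B⌋₊).filter (fun R => A < (Ideal.absNorm R : ℝ)) =
        idealsLE ⌊B⌋₊ \ idealsLE ⌊A⌋₊ := by
      ext R
      simp only [mem_filter, Finset.mem_sdiff, mem_idealsLE]
      constructor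
      · rintro ⟨h1, h2⟩
        refine ⟨h1, fun h3 => ?_⟩
        have : (Ideal.absNorm R : ℝ) ≤ A := (Nat.le_floor_iff hA0.le).mp h3
        linarith
      · rintro ⟨h1, h2⟩
        refine ⟨h1, ?_⟩
        by_contra h3
        exact h2 ((Nat.le_floor_iff hA0.le).mpr (not_lt.mp h3))
    rw [hsplit]
    have hsub : idealsLE ⌊A⌋₊ ⊆ idealsLE ⌊B⌋₊ := by
      intro R hR; rw [mem_idealsLE] at hR ⊢; exact hR.trans (Nat.floor_le_floor hAB)
    rw [card_sdiff_of_subset hsub, Nat.cast_sub (Finset.card_le_card hsub), card_idealsLE_eq, card_idealsLE_eq]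
    have hBfl : (1 : ℝ) ≤ ⌊B⌋₊ := by exact_mod_cast (Nat.one_le_floor_iff B).mpr (by linarith)
    have hAfl : (1 : ℝ) ≤ ⌊A⌋₊ := by exact_mod_cast (Nat.one_le_floor_iff A).mpr hA
    have hC₀' : ∀ x : ℝ, 1 ≤ x → |(I x : ℝ) - gamma₀ * x| ≤ C₀ * x ^ (1 - 1 / (Module.finrank ℚ K : ℝ)) :=
      hC₀
    have h1 := (abs_le.mp (hC₀' _ hBfl)).2
    have h2 := (abs_le.mp (hC₀' _ hAfl)).1
    rw [hexp] at h1 h2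
    have hBfl' : (⌊B⌋₊ : ℝ) ≤ B := Nat.floor_le (by linarith)
    have hAfl' : A - 1 ≤ (⌊A⌋₊ : ℝ) := by linarith [Nat.lt_floor_add_one A]
    have hAfl'' : (⌊A⌋₊ : ℝ) ≤ A := Nat.floor_le hA0.le
    have hp1 : (⌊B⌋₊ : ℝ) ^ (2 / 3 : ℝ) ≤ (2 * A) ^ (2 / 3 : ℝ) :=
      Real.rpow_le_rpow (by positivity) (hBfl'.trans hB2) (by norm_num)
    have hp2 : (⌊A⌋₊ : ℝ) ^ (2 / 3 : ℝ) ≤ A ^ (2 / 3 : ℝ) :=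
      Real.rpow_le_rpow (by positivity) hAfl'' (by norm_num)
    have hp3 : (2 * A) ^ (2 / 3 : ℝ) ≤ 2 * A ^ (2 / 3 : ℝ) := by
      rw [Real.mul_rpow (by norm_num) hA0.le]
      refine mul_le_mul_of_nonneg_right ?_ (by positivity)
      calc (2 : ℝ) ^ (2 / 3 : ℝ) ≤ 2 ^ (1 : ℝ) := Real.rpow_le_rpow_of_exponent_le one_le_two (by norm_num)
        _ = 2 := Real.rpow_one 2
    change (I ⌊B⌋₊ : ℝ) + 1 - ((I ⌊A⌋₊ : ℝ) + 1) ≤ _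
    have hBA : B - (A - 1) = η * A + 1 := by rw [hB]; ring
    have e1 : gamma₀ * (⌊B⌋₊ : ℝ) ≤ gamma₀ * B := mul_le_mul_of_nonneg_left hBfl' hρ0.le
    have e2 : gamma₀ * (A - 1) ≤ gamma₀ * (⌊A⌋₊ : ℝ) := mul_le_mul_of_nonneg_left hAfl' hρ0.le
    have e3 : C₀ * (⌊B⌋₊ : ℝ) ^ (2 / 3 : ℝ) ≤ C₀ * (2 * A ^ (2 / 3 : ℝ)) :=
      mul_le_mul_of_nonneg_left (hp1.trans hp3) hC₀0
    have e4 : C₀ * (⌊A⌋₊ : ℝ) ^ (2 / 3 : ℝ) ≤ C₀ * A ^ (2 / 3 : ℝ) := mul_le_mul_of_nonneg_left hp2 hC₀0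
    have e5 : gamma₀ * B - gamma₀ * (A - 1) = gamma₀ * η * A + gamma₀ := by rw [hB]; ring
    linarith
  -- each term is `≤ 1/A`
  calc ∑ R ∈ (idealsLE ⌊B⌋₊).filter (fun R => A < (Ideal.absNorm R : ℝ)), ((Ideal.absNorm R : ℕ) : ℝ)⁻¹
      ≤ ∑ R ∈ (idealsLE ⌊B⌋₊).filter (fun R => A < (Ideal.absNorm R : ℝ)), A⁻¹ := by
        refine sum_le_sum fun R hR => ?_
        obtain ⟨-, hAR⟩ := mem_filter.mp hR
        exact inv_anti₀ hA0 hAR.le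
    _ = #((idealsLE ⌊B⌋₊).filter (fun R => A < (Ideal.absNorm R : ℝ))) * A⁻¹ := by
        rw [sum_const, nsmul_eq_mul]
    _ ≤ (gamma₀ * η * A + gamma₀ + 3 * C₀ * A ^ (2 / 3 : ℝ)) * A⁻¹ :=
        mul_le_mul_of_nonneg_right hcount (by positivity)
    _ = gamma₀ * η + (gamma₀ * A⁻¹ + 3 * C₀ * (A ^ (2 / 3 : ℝ) * A⁻¹)) := by field_simp; ring
    _ ≤ gamma₀ * η + (2 * gamma₀ + 3 * C₀ + 1) * A ^ (-(1 / 3 : ℝ)) := by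
        have h13 : A ^ (2 / 3 : ℝ) * A⁻¹ = A ^ (-(1 / 3 : ℝ)) := by
          rw [← Real.rpow_neg_one, ← Real.rpow_add hA0]; norm_num
        have hinv : A⁻¹ ≤ A ^ (-(1 / 3 : ℝ)) := by
          rw [← Real.rpow_neg_one]
          exact Real.rpow_le_rpow_of_exponent_le hA (by norm_num)
        have hp0 : 0 ≤ A ^ (-(1 / 3 : ℝ)) := Real.rpow_nonneg hA0.le _
        rw [h13]
        nlinarith [mul_le_mul_of_nonneg_left hinv hρ0.le]

end Counting

/-! ### The parameters for large `X` -/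

section Params

/-- (9.5) in the form used here: if `c ≥ 0`, `Λ > 0` and `jc ≤ Λ` then `(c + Λ)^j ≤ e·Λ^j`
(`(1 + c/Λ)^j ≤ exp(jc/Λ) ≤ e`). [cite: HeathBrownActa2001, §9 (9.5)] -/
theorem add_pow_le_exp_mul_pow {c Λ : ℝ} (hc : 0 ≤ c) (hΛ : 0 < Λ) {j : ℕ} (hj : (j : ℝ) * c ≤ Λ) :
    (c + Λ) ^ j ≤ Real.exp 1 * Λ ^ j := by
  have h1 : c + Λ = Λ * (1 + c / Λ) := by field_simp; ring
  rw [h1, mul_pow, mul_comm]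
  refine mul_le_mul_of_nonneg_right ?_ (pow_nonneg hΛ.le _)
  calc (1 + c / Λ) ^ j ≤ Real.exp (c / Λ) ^ j :=
        pow_le_pow_left₀ (by positivity) (by linarith [Real.add_one_le_exp (c / Λ)]) j
    _ = Real.exp (j * (c / Λ)) := by rw [← Real.exp_nat_mul]
    _ ≤ Real.exp 1 := Real.exp_le_exp.mpr (by rw [mul_div_assoc'] ; exact (div_le_one hΛ).mpr hj)

/-- `log L ≤ 3L^{1/3}` for `L ≥ 0`. [folklore] -/
theorem log_le_three_mul_rpow_third {L : ℝ} (hL : 0 ≤ L) : Real.log L ≤ 3 * L ^ (1 / 3 : ℝ) := by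
  have := Real.log_le_rpow_div hL (by norm_num : (0 : ℝ) < 1 / 3)
  linarith [this]

/-- **The inequalities for large `X` behind (10.5)**: eventually in `X`, with `L = log X`, `τ = (log L)^{−ϖ}`
(`0 < ϖ ≤ 1`), `ξ = τ⁵`, `Λ = ξL` ((2.5), (3.4), (3.9)): `X ≥ 2`, `L ≥ 8`, `0 < τ ≤ 1`, `X^τ ≥ 3`, `Λ ≥ 1`,
`τ⁶L ≥ B₁`, `B₂L ≤ Λ²`, `K₀ L exp(−c₂√(τL)) ≤ exp(−2L^{1/3})` (this is "`exp{−c(log L)^{1/2}} ≪ η²` by (2.1), (2.5)",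
p. 65, as `√(τL) ≫ L^{1/3}(log L)`) and `X^{−1/2} ≤ exp(−L^{1/3})` (each from `(log L)^ϖ = o(L^a)`).
[cite: HeathBrownActa2001, §10 p. 65] -/
theorem eventually_leadingB_params {ϖ : ℝ} (hϖ0 : 0 < ϖ) (hϖ1 : ϖ ≤ 1) (B₁ B₂ : ℝ) {c₂ K₀ : ℝ}
    (hc₂ : 0 < c₂) (hK₀ : 0 < K₀) :
    ∀ᶠ X : ℝ in atTop,
      2 ≤ X ∧ 8 ≤ Real.log X ∧ 0 < hbTau ϖ X ∧ hbTau ϖ X ≤ 1 ∧ 3 ≤ X ^ hbTau ϖ X ∧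
      1 ≤ hbXi (hbTau ϖ X) * Real.log X ∧ B₁ ≤ hbTau ϖ X ^ 6 * Real.log X ∧
      B₂ * Real.log X ≤ (hbXi (hbTau ϖ X) * Real.log X) ^ 2 ∧
      K₀ * Real.log X * Real.exp (-c₂ * Real.sqrt (hbTau ϖ X * Real.log X)) ≤
        Real.exp (-2 * Real.log X ^ (1 / 3 : ℝ)) ∧
      X ^ (-(1 / 2 : ℝ)) ≤ Real.exp (-Real.log X ^ (1 / 3 : ℝ)) := by
  set κ : ℝ := 5 + |Real.log K₀| with hκ
  have hκ0 : 0 < κ := by positivity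
  filter_upwards [eventually_ge_atTop (2 : ℝ),
    Real.tendsto_log_atTop.eventually (eventually_ge_atTop (8 : ℝ)),
    eventually_hbTau_pow_mul_log hϖ0 hϖ1 1 2 one_pos,
    eventually_hbTau_pow_mul_log hϖ0 hϖ1 5 1 one_pos,
    eventually_hbTau_pow_mul_log hϖ0 hϖ1 6 B₁ one_pos,
    eventually_hbTau_pow_mul_log hϖ0 hϖ1 10 B₂ one_pos,
    Literature.NumberTheory.Sieve.CubicSieve.eventually_loglog_rpow_le ϖ (κ ^ 2 / c₂ ^ 2)
      (by norm_num : (0 : ℝ) < 1 / 3),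
    (Real.tendsto_log_atTop.comp Real.tendsto_log_atTop).eventually (eventually_gt_atTop (0 : ℝ))]
    with X hX2 hL8 h1 h5 h6 h10 hll hM0
  set L := Real.log X with hL
  have hL0 : 0 < L := by linarith
  have hL1 : 1 ≤ L := by linarith
  set τ := hbTau ϖ X with hτdef
  have hM0' : 0 < Real.log L := hM0
  have hτ0 : 0 < τ := by rw [hτdef, hbTau]; exact Real.rpow_pos_of_pos hM0' _
  have hτ1 : τ ≤ 1 := h1.2
  -- `X^τ ≥ 3`: `τ L ≥ 2 ≥ log 3`
  have hXτ : 3 ≤ X ^ τ := by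
    have h : Real.log 3 ≤ τ * L := by
      have hl3 : Real.log 3 < 2 := by
        have := Real.log_lt_sub_one_of_pos (by norm_num : (0:ℝ) < 3) (by norm_num); linarith
      have := h1.1; rw [pow_one] at this; linarith
    calc (3 : ℝ) = Real.exp (Real.log 3) := (Real.exp_log (by norm_num)).symm
      _ ≤ Real.exp (τ * L) := Real.exp_le_exp.mpr h
      _ = X ^ τ := by rw [hL, Real.rpow_def_of_pos (by linarith), mul_comm]
  have hΛ : hbXi τ * L = τ ^ 5 * L := by rw [hbXi]
  refine ⟨hX2, hL8, hτ0, hτ1, hXτ, by rw [hΛ]; exact h5.1, h6.1, ?_, ?_, ?_⟩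
  · -- `B₂ L ≤ Λ² = τ^10 L²`
    rw [hΛ]
    have := h10.1
    nlinarith
  · -- `K₀ L exp(−c₂√(τL)) ≤ exp(−2L^{1/3})`
    have hL13 : 1 ≤ L ^ (1 / 3 : ℝ) := Real.one_le_rpow hL1 (by norm_num)
    have hL130 : 0 < L ^ (1 / 3 : ℝ) := by linarith
    -- `κ L^{1/3} ≤ c₂ √(τL)`
    have hτL : τ * L = L / Real.log L ^ ϖ := by
      rw [hτdef, hbTau, ← hL, Real.rpow_neg hM0'.le, div_eq_mul_inv, mul_comm]
    have hkey : κ ^ 2 * L ^ (2 / 3 : ℝ) ≤ c₂ ^ 2 * (τ * L) := by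
      have hMϖ : 0 < Real.log L ^ ϖ := Real.rpow_pos_of_pos hM0' _
      rw [hτL, mul_div_assoc', le_div_iff₀ hMϖ]
      have h23 : L ^ (2 / 3 : ℝ) * L ^ (1 / 3 : ℝ) = L := by
        rw [← Real.rpow_add hL0]; norm_num
      calc κ ^ 2 * L ^ (2 / 3 : ℝ) * Real.log L ^ ϖ
          = c₂ ^ 2 * (κ ^ 2 / c₂ ^ 2 * Real.log L ^ ϖ) * L ^ (2 / 3 : ℝ) := by field_simp
        _ ≤ c₂ ^ 2 * L ^ (1 / 3 : ℝ) * L ^ (2 / 3 : ℝ) := by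
            refine mul_le_mul_of_nonneg_right (mul_le_mul_of_nonneg_left hll (sq_nonneg _)) ?_
            exact Real.rpow_nonneg hL0.le _
        _ = c₂ ^ 2 * L := by rw [mul_assoc, mul_comm (L ^ (1/3:ℝ)), h23]
    have hsq : κ * L ^ (1 / 3 : ℝ) ≤ c₂ * Real.sqrt (τ * L) := by
      have h0 : 0 ≤ κ * L ^ (1 / 3 : ℝ) := by positivity
      have hsqL : (L ^ (1 / 3 : ℝ)) ^ 2 = L ^ (2 / 3 : ℝ) := by
        rw [← Real.rpow_natCast, ← Real.rpow_mul hL0.le]; norm_num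
      calc κ * L ^ (1 / 3 : ℝ) = Real.sqrt ((κ * L ^ (1 / 3 : ℝ)) ^ 2) := (Real.sqrt_sq h0).symm
        _ ≤ Real.sqrt (c₂ ^ 2 * (τ * L)) := Real.sqrt_le_sqrt (by rw [mul_pow, hsqL]; exact hkey)
        _ = c₂ * Real.sqrt (τ * L) := by rw [Real.sqrt_mul (sq_nonneg _), Real.sqrt_sq hc₂.le]
    -- assemble with `log L ≤ 3L^{1/3}`, `log K₀ ≤ |log K₀| L^{1/3}`
    have hlogL : Real.log L ≤ 3 * L ^ (1 / 3 : ℝ) := log_le_three_mul_rpow_third hL0.le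
    have hlogK : Real.log K₀ ≤ |Real.log K₀| * L ^ (1 / 3 : ℝ) := by
      calc Real.log K₀ ≤ |Real.log K₀| := le_abs_self _
        _ = |Real.log K₀| * 1 := (mul_one _).symm
        _ ≤ |Real.log K₀| * L ^ (1 / 3 : ℝ) := mul_le_mul_of_nonneg_left hL13 (abs_nonneg _)
    have hexp : Real.log K₀ + Real.log L + -c₂ * Real.sqrt (τ * L) ≤ -2 * L ^ (1 / 3 : ℝ) := by
      have : Real.log K₀ + Real.log L + 2 * L ^ (1 / 3 : ℝ) ≤ κ * L ^ (1 / 3 : ℝ) := by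
        rw [hκ]; nlinarith
      linarith
    calc K₀ * L * Real.exp (-c₂ * Real.sqrt (τ * L))
        = Real.exp (Real.log K₀ + Real.log L + -c₂ * Real.sqrt (τ * L)) := by
          rw [Real.exp_add, Real.exp_add, Real.exp_log hK₀, Real.exp_log hL0]
      _ ≤ Real.exp (-2 * L ^ (1 / 3 : ℝ)) := Real.exp_le_exp.mpr hexp
  · -- `X^{-1/2} = exp(−L/2) ≤ exp(−L^{1/3})`
    have hX0 : 0 < X := by linarith
    rw [Real.rpow_def_of_pos hX0, ← hL]
    refine Real.exp_le_exp.mpr ?_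
    -- `L^{1/3} ≤ L/2` for `L ≥ 8`
    set u := L ^ (1 / 3 : ℝ) with hu
    have hu0 : 0 ≤ u := Real.rpow_nonneg hL0.le _
    have hu3 : u ^ 3 = L := by
      rw [hu, ← Real.rpow_natCast, ← Real.rpow_mul hL0.le]; norm_num
    have hu2 : 2 ≤ u := by nlinarith [sq_nonneg u, sq_nonneg (u - 2), sq_nonneg (u + 2)]
    nlinarith [sq_nonneg u]

end Params

/-! ### `U(ℬ) − 3ηX³Σ₃` as a sum over `R ≠ 0` -/

section Reduction

variable {X η τ : ℝ}

/-- `|c_R| ≤ 1` under the support condition of (3.3) (`c_R ∈ {0, 1}`). [cite: HeathBrownActa2001, §3 (3.3)] -/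
theorem abs_le_one_of_cSupport {c : Ideal (𝓞 K) → ℝ} (hc : CSupport X τ c) (R : Ideal (𝓞 K)) :
    |c R| ≤ 1 := by
  rcases hc.1 R with h | h <;> simp [h]

/-- **The reduction to `R ≠ 0`**: for `X ≥ 1`, `τ > 0`, `η ≥ 0` and `c_R` as in (3.3),
`|U(ℬ) − 3ηX³Σ₃| ≤ ∑_{0 < N(R) ≤ 3X³(1+η)} (M(ξ log X)^{n+1})⁻¹ |Σ_R − ηY_R w'(Y_R)|`, `Y_R = 3X³/N(R)` — both sides
written as sums over `R` (`bilin_normWindow_dWeight_eq`, `sigma3_eq_sum_large`), `3ηX³/(M(ξ log X)^{n+1}N(R)) =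
(M(ξ log X)^{n+1})⁻¹ ηY_R`, `|c_R| ≤ 1`, and the term `R = 0` vanishes. [cite: HeathBrownActa2001, §10 p. 64] -/
theorem abs_bilinB_sub_main_le (hX : 1 ≤ X) (hτ : 0 < τ) (hη : 0 ≤ η) {k : ℕ} (m : Fin k → ℕ)
    {c : Ideal (𝓞 K) → ℝ} (hc : CSupport X τ c) :
    |bilin (normWindow X η) (fun J => J) c (dWeight X τ m) - 3 * η * X ^ 3 * sigma3 X τ m c| ≤
      ∑ R ∈ (idealsLE ⌊3 * X ^ 3 * (1 + η)⌋₊).filter (fun R => R ≠ ⊥),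
        (∏ i, ((m i : ℝ) * hbXi τ * Real.log X))⁻¹ *
          |(∑ P ∈ Fintype.piFinset (fun i => Jprimes X τ (m i)),
              if 3 * X ^ 3 < (Ideal.absNorm R : ℝ) * ∏ i, (Ideal.absNorm (P i) : ℝ) ∧
                  (Ideal.absNorm R : ℝ) * ∏ i, (Ideal.absNorm (P i) : ℝ) ≤ 3 * X ^ 3 * (1 + η)
                then ∏ i, Real.log (Ideal.absNorm (P i)) else 0) -
            η * (3 * X ^ 3 / Ideal.absNorm R) * wDeriv X τ m (3 * X ^ 3 / Ideal.absNorm R)| := by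
  classical
  have hX0 : 0 < X := by linarith
  set D : ℝ := ∏ i, ((m i : ℝ) * hbXi τ * Real.log X) with hD
  have hD0 : 0 ≤ D := prod_nonneg fun i _ =>
    mul_nonneg (mul_nonneg (Nat.cast_nonneg _) (hbXi_pos hτ).le) (Real.log_nonneg hX)
  set Rset := idealsLE ⌊3 * X ^ 3 * (1 + η)⌋₊ with hRset
  set Sw : Ideal (𝓞 K) → ℝ := fun R => ∑ P ∈ Fintype.piFinset (fun i => Jprimes X τ (m i)),
      if 3 * X ^ 3 < (Ideal.absNorm R : ℝ) * ∏ i, (Ideal.absNorm (P i) : ℝ) ∧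
          (Ideal.absNorm R : ℝ) * ∏ i, (Ideal.absNorm (P i) : ℝ) ≤ 3 * X ^ 3 * (1 + η)
        then ∏ i, Real.log (Ideal.absNorm (P i)) else 0 with hSw
  rw [bilin_normWindow_dWeight_eq hX0 c m, sigma3_eq_sum_large hX hτ hη m c, mul_sum, ← sum_sub_distrib]
  -- the term at `R` is `c_R D⁻¹ (Σ_R − ηY_R w')`, and vanishes at `R = 0`
  have hterm : ∀ R ∈ Rset, c R * (D⁻¹ * Sw R) -
      3 * η * X ^ 3 * (c R * wDeriv X τ m (3 * X ^ 3 / Ideal.absNorm R) / (D * Ideal.absNorm R)) =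
      if R = ⊥ then 0 else c R * D⁻¹ * (Sw R -
        η * (3 * X ^ 3 / Ideal.absNorm R) * wDeriv X τ m (3 * X ^ 3 / Ideal.absNorm R)) := by
    intro R _
    split_ifs with hR
    · -- `R = 0`: `Σ_0 = 0` (the window condition fails) and the second term is `x/0 = 0`
      subst hR
      have hS0 : Sw ⊥ = 0 := by
        simp only [hSw]
        refine sum_eq_zero fun P _ => ?_
        rw [Ideal.absNorm_bot, Nat.cast_zero, zero_mul, if_neg]
        rintro ⟨h1, -⟩
        linarith [pow_pos hX0 3]
      rw [hS0]
      simp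
    · rw [div_eq_mul_inv, mul_inv]
      ring
  have hfilt : ∑ R ∈ Rset, (if R = ⊥ then 0 else c R * D⁻¹ * (Sw R -
        η * (3 * X ^ 3 / Ideal.absNorm R) * wDeriv X τ m (3 * X ^ 3 / Ideal.absNorm R))) =
      ∑ R ∈ Rset.filter (fun R => R ≠ ⊥), c R * D⁻¹ * (Sw R -
        η * (3 * X ^ 3 / Ideal.absNorm R) * wDeriv X τ m (3 * X ^ 3 / Ideal.absNorm R)) := by
    rw [sum_filter]
    refine sum_congr rfl fun R _ => ?_
    by_cases h : R = ⊥ <;> simp [h]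
  rw [sum_congr rfl hterm, hfilt]
  refine (abs_sum_le_sum_abs _ _).trans (sum_le_sum fun R hR => ?_)
  rw [abs_mul, abs_mul, abs_of_nonneg (inv_nonneg.mpr hD0)]
  calc |c R| * D⁻¹ * |Sw R - η * (3 * X ^ 3 / Ideal.absNorm R) * wDeriv X τ m (3 * X ^ 3 / Ideal.absNorm R)|
      ≤ 1 * D⁻¹ * |Sw R - η * (3 * X ^ 3 / Ideal.absNorm R) * wDeriv X τ m (3 * X ^ 3 / Ideal.absNorm R)| := by
        gcongr
        exact abs_le_one_of_cSupport hc R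
    _ = _ := by rw [one_mul]

end Reduction

/-! ### (10.5): `U(ℬ) = 3ηX³Σ₃ + O(η²M⁻¹X³)` -/

section Assembly

/-- `log 6 ≤ 2` (`6 < e²`). [folklore] -/
theorem log_six_le_two : Real.log 6 ≤ 2 := by
  rw [Real.log_le_iff_le_exp (by norm_num)]
  have h1 := Real.exp_one_gt_d9
  have : Real.exp 2 = Real.exp 1 ^ 2 := by rw [← Real.exp_nat_mul]; norm_num
  rw [this]; nlinarith

/-- `1[A ∨ B]·ηv ≤ η·1[A]v + η·1[B]v` for `η, v ≥ 0`. [folklore] -/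
theorem ite_or_mul_le {A B : Prop} [Decidable A] [Decidable B] {η v : ℝ} (hη : 0 ≤ η) (hv : 0 ≤ v) :
    (if A ∨ B then η * v else 0) ≤ η * (if A then v else 0) + η * (if B then v else 0) := by
  have h0 := mul_nonneg hη hv
  by_cases hA : A
  · by_cases hB : B
    · rw [if_pos (Or.inl hA), if_pos hA, if_pos hB]; linarith
    · rw [if_pos (Or.inl hA), if_pos hA, if_neg hB, mul_zero, add_zero]
  · by_cases hB : B
    · rw [if_pos (Or.inr hB), if_neg hA, if_pos hB, mul_zero, zero_add]
    · rw [if_neg (not_or.mpr ⟨hA, hB⟩), if_neg hA, if_neg hB, mul_zero, add_zero]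

/-- **The exceptional `R` for one endpoint** (p. 66: "where the sum over `R` in the error term is for
`N(R) = 3X³X^{−m_1ξ}{1 + O(η)}` or `3X³X^{−(1+m_1)ξ}{1 + O(η)}`"): for an endpoint `E > 0` (`X > 0`),
`∑_{R ≠ 0 : E ∈ (Y_R, Y_R(1+η)]} Y_R ≤ 3X³ ∑_{3X³/E < N(R) ≤ (3X³/E)(1+η)} 1/N(R)`. [cite: HeathBrownActa2001, §10 p. 66] -/
theorem sum_exceptional_le {X η : ℝ} (hX : 0 < X) {E : ℝ} (hE : 0 < E)
    (Rset : Finset (Ideal (𝓞 K))) :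
    ∑ R ∈ Rset.filter (fun R => R ≠ ⊥),
        (if E ∈ Set.Ioc (3 * X ^ 3 / (Ideal.absNorm R : ℝ)) (3 * X ^ 3 / (Ideal.absNorm R : ℝ) * (1 + η))
          then 3 * X ^ 3 / (Ideal.absNorm R : ℝ) else 0) ≤
      3 * X ^ 3 * ∑ R ∈ (idealsLE ⌊3 * X ^ 3 / E * (1 + η)⌋₊).filter
        (fun R => 3 * X ^ 3 / E < (Ideal.absNorm R : ℝ)), ((Ideal.absNorm R : ℕ) : ℝ)⁻¹ := by
  classical
  set A : ℝ := 3 * X ^ 3 / E with hA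
  have hA0 : 0 < A := by positivity
  rw [mul_sum, ← sum_filter]
  have hsub : (Rset.filter (fun R => R ≠ ⊥)).filter (fun R => E ∈ Set.Ioc (3 * X ^ 3 / (Ideal.absNorm R : ℝ))
      (3 * X ^ 3 / (Ideal.absNorm R : ℝ) * (1 + η))) ⊆
      (idealsLE ⌊A * (1 + η)⌋₊).filter (fun R => A < (Ideal.absNorm R : ℝ)) := by
    intro R hR
    rw [mem_filter, mem_filter] at hR
    obtain ⟨⟨-, hR0⟩, ⟨h1, h2⟩⟩ := hR
    have hN : 0 < (Ideal.absNorm R : ℝ) := by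
      have : Ideal.absNorm R ≠ 0 := fun h => hR0 (Ideal.absNorm_eq_zero_iff.mp h)
      positivity
    have hAlt : A < (Ideal.absNorm R : ℝ) := by
      rw [hA, div_lt_iff₀ hE]; rw [div_lt_iff₀ hN] at h1; linarith
    have hle : (Ideal.absNorm R : ℝ) ≤ A * (1 + η) := by
      rw [hA, div_mul_eq_mul_div, le_div_iff₀ hE]
      rw [div_mul_eq_mul_div, le_div_iff₀ hN] at h2; linarith
    exact mem_filter.mpr ⟨mem_idealsLE.mpr (Nat.le_floor hle), hAlt⟩
  calc ∑ R ∈ (Rset.filter (fun R => R ≠ ⊥)).filter (fun R => E ∈ Set.Ioc (3 * X ^ 3 / (Ideal.absNorm R : ℝ))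
          (3 * X ^ 3 / (Ideal.absNorm R : ℝ) * (1 + η))), 3 * X ^ 3 / (Ideal.absNorm R : ℝ)
      ≤ ∑ R ∈ (idealsLE ⌊A * (1 + η)⌋₊).filter (fun R => A < (Ideal.absNorm R : ℝ)),
          3 * X ^ 3 / (Ideal.absNorm R : ℝ) :=
        sum_le_sum_of_subset_of_nonneg hsub fun R _ _ => by positivity
    _ = ∑ R ∈ (idealsLE ⌊A * (1 + η)⌋₊).filter (fun R => A < (Ideal.absNorm R : ℝ)),
          3 * X ^ 3 * ((Ideal.absNorm R : ℕ) : ℝ)⁻¹ :=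
        sum_congr rfl fun R _ => by rw [div_eq_mul_inv]

variable {X η τ : ℝ}

/-- **Summing the per-`R` bounds**: if for every `R ≠ 0` of norm `≤ 3X³(1+η)`,
`|T(Y_R(1+η)) − T(Y_R) − ηY_R w'(Y_R)| ≤ 3AY_R + MV_R` (`Y_R = 3X³/N(R)`, `T` the tuple sum of Lemma 4.10), then
`|U(ℬ) − 3ηX³Σ₃| ≤ (M(ξ log X)^{n+1})⁻¹ (9AX³ ∑_R 1/N(R) + ∑_R MV_R)`. [cite: HeathBrownActa2001, §10 pp. 64–65] -/
theorem abs_bilinB_sub_main_le_of_perR (hX : 1 ≤ X) (hτ : 0 < τ) (hη : 0 ≤ η) {k : ℕ} (m : Fin k → ℕ)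
    {c : Ideal (𝓞 K) → ℝ} (hc : CSupport X τ c) {A : ℝ} {MV : Ideal (𝓞 K) → ℝ}
    (hper : ∀ R ∈ (idealsLE ⌊3 * X ^ 3 * (1 + η)⌋₊).filter (fun R => R ≠ ⊥),
      |(∑ P ∈ Fintype.piFinset (fun i => Jprimes X τ (m i)),
            if ∏ i, (Ideal.absNorm (P i) : ℝ) ≤ 3 * X ^ 3 / (Ideal.absNorm R : ℝ) * (1 + η)
              then ∏ i, Real.log (Ideal.absNorm (P i)) else 0) -
          (∑ P ∈ Fintype.piFinset (fun i => Jprimes X τ (m i)),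
            if ∏ i, (Ideal.absNorm (P i) : ℝ) ≤ 3 * X ^ 3 / (Ideal.absNorm R : ℝ)
              then ∏ i, Real.log (Ideal.absNorm (P i)) else 0) -
          η * (3 * X ^ 3 / (Ideal.absNorm R : ℝ)) * wDeriv X τ m (3 * X ^ 3 / (Ideal.absNorm R : ℝ))| ≤
        3 * A * (3 * X ^ 3 / (Ideal.absNorm R : ℝ)) + MV R) :
    |bilin (normWindow X η) (fun J => J) c (dWeight X τ m) - 3 * η * X ^ 3 * sigma3 X τ m c| ≤
      (∏ i, ((m i : ℝ) * hbXi τ * Real.log X))⁻¹ *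
        (3 * A * (3 * X ^ 3 * ∑ R ∈ (idealsLE ⌊3 * X ^ 3 * (1 + η)⌋₊).filter (fun R => R ≠ ⊥),
            ((Ideal.absNorm R : ℕ) : ℝ)⁻¹) +
          ∑ R ∈ (idealsLE ⌊3 * X ^ 3 * (1 + η)⌋₊).filter (fun R => R ≠ ⊥), MV R) := by
  classical
  have hX0 : 0 < X := by linarith
  set S := (idealsLE ⌊3 * X ^ 3 * (1 + η)⌋₊).filter (fun R => R ≠ ⊥) with hS
  set Dinv : ℝ := (∏ i, ((m i : ℝ) * hbXi τ * Real.log X))⁻¹ with hDinv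
  have hDinv0 : 0 ≤ Dinv := inv_nonneg.mpr (prod_nonneg fun i _ =>
    mul_nonneg (mul_nonneg (Nat.cast_nonneg _) (hbXi_pos hτ).le) (Real.log_nonneg hX))
  have hRHS : Dinv * (3 * A * (3 * X ^ 3 * ∑ R ∈ S, ((Ideal.absNorm R : ℕ) : ℝ)⁻¹) + ∑ R ∈ S, MV R) =
      ∑ R ∈ S, Dinv * (3 * A * (3 * X ^ 3 * ((Ideal.absNorm R : ℕ) : ℝ)⁻¹) + MV R) := by
    rw [mul_sum, mul_sum, ← sum_add_distrib, mul_sum]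
  rw [hRHS]
  refine (abs_bilinB_sub_main_le hX hτ hη m hc).trans (sum_le_sum fun R hR => ?_)
  refine mul_le_mul_of_nonneg_left ?_ hDinv0
  obtain ⟨-, hR0⟩ := mem_filter.mp hR
  have hN : 0 < (Ideal.absNorm R : ℝ) := by
    have : Ideal.absNorm R ≠ 0 := fun h => hR0 (Ideal.absNorm_eq_zero_iff.mp h)
    positivity
  rw [windowTupleSum_eq_sub hX0.le hη _ hN]
  refine (hper R hR).trans (le_of_eq ?_)
  rw [div_eq_mul_inv (3 * X ^ 3) (Ideal.absNorm R : ℝ)]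

/-- **The numerics of the Lemma-4.10 error** (pp. 64–65: "The error term above contributes to `∑ d_S` a total
`≪ X³/(MN(R)) exp{−c(log L)^{1/2}}`, by (2.5) [and (9.5)], which produces a contribution
`≪ M⁻¹X³ exp{−c(log L)^{1/2}} ∑_R c_R/N(R)` … `= O((X³/M)exp{−c(log L)^{1/2}}) = O(η²M⁻¹X³)` by (2.1)"): with
`Λ = ξ log X`, `n + 1 ≤ Λ`, `nc₁ ≤ Λ` (so `(n+1)(c₁+Λ)^n ≤ eΛ^{n+1}`, (9.5)), `∑ 1/N(R) ≤ 4C_H log X` and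
`100(C₄+1)C_H(log X)ε ≤ η²`: `(MΛ^{n+1})⁻¹·3(C₄(n+1)(c₁+Λ)^nε)·3X³H ≤ M⁻¹η²X³`. [cite: HeathBrownActa2001, §10 p. 65] -/
theorem term1_le {M Λ ε X Hs C₄ CH c₁ L η : ℝ} {n : ℕ} (hM : 0 < M) (hΛ : 0 < Λ) (hc₁ : 0 ≤ c₁)
    (hC₄ : 0 ≤ C₄) (hCH : 0 < CH) (hε : 0 < ε) (hX : 0 < X) (hHs0 : 0 ≤ Hs) (hHs : Hs ≤ 4 * CH * L)
    (hn1 : (n : ℝ) + 1 ≤ Λ) (hn2 : (n : ℝ) * c₁ ≤ Λ) (hK : 100 * (C₄ + 1) * CH * L * ε ≤ η ^ 2) :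
    (M * Λ ^ (n + 1))⁻¹ * (3 * (C₄ * ((n : ℝ) + 1) * (c₁ + Λ) ^ n * ε) * (3 * X ^ 3 * Hs)) ≤
      M⁻¹ * η ^ 2 * X ^ 3 := by
  have hpow := add_pow_le_exp_mul_pow hc₁ hΛ hn2
  have he : Real.exp 1 < 2.72 := by have := Real.exp_one_lt_d9; linarith
  have hL : 0 ≤ L := by nlinarith
  -- `(n+1)(c₁+Λ)^n ≤ e Λ^{n+1}`
  have hbr : ((n : ℝ) + 1) * (c₁ + Λ) ^ n ≤ Real.exp 1 * Λ ^ (n + 1) := by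
    calc ((n : ℝ) + 1) * (c₁ + Λ) ^ n ≤ Λ * (Real.exp 1 * Λ ^ n) :=
          mul_le_mul hn1 hpow (by positivity) hΛ.le
      _ = Real.exp 1 * Λ ^ (n + 1) := by ring
  have hΛn : 0 < Λ ^ (n + 1) := pow_pos hΛ _
  calc (M * Λ ^ (n + 1))⁻¹ * (3 * (C₄ * ((n : ℝ) + 1) * (c₁ + Λ) ^ n * ε) * (3 * X ^ 3 * Hs))
      = 9 * C₄ * ε * X ^ 3 * Hs * M⁻¹ * ((((n : ℝ) + 1) * (c₁ + Λ) ^ n) * (Λ ^ (n + 1))⁻¹) := by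
        rw [mul_inv]; ring
    _ ≤ 9 * C₄ * ε * X ^ 3 * Hs * M⁻¹ * (Real.exp 1) := by
        refine mul_le_mul_of_nonneg_left ?_ (by positivity)
        rw [mul_inv_le_iff₀ hΛn]
        exact hbr
    _ ≤ 9 * C₄ * ε * X ^ 3 * (4 * CH * L) * M⁻¹ * 2.72 := by gcongr
    _ ≤ (100 * (C₄ + 1) * CH * L * ε) * X ^ 3 * M⁻¹ := by
        have h1 : 9 * C₄ * (4 * CH) * 2.72 ≤ 100 * (C₄ + 1) * CH := by nlinarith
        have h2 : 0 ≤ ε * X ^ 3 * L * M⁻¹ := by positivity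
        nlinarith
    _ ≤ η ^ 2 * X ^ 3 * M⁻¹ := by gcongr
    _ = M⁻¹ * η ^ 2 * X ^ 3 := by ring


/-- **One exceptional endpoint costs `O(η)`** (p. 66, via Lemma 4.1): for `X ≥ 2`, `0 ≤ η ≤ 1`, `0 < E ≤ X^{3/2}`
and `X^{−1/2} ≤ η` (so that `A = 3X³/E ≥ 3X^{3/2}`, `A^{−1/3} ≤ X^{−1/2} ≤ η`),
`∑_{R ≠ 0 : E ∈ (Y_R, Y_R(1+η)]} Y_R ≤ 3X³(γ₀ + C_w)η`. [cite: HeathBrownActa2001, §10 p. 66] -/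
theorem sum_exceptional_le_eta {Cw : ℝ} (hCw : 0 < Cw)
    (hWin : ∀ A η : ℝ, 1 ≤ A → 0 ≤ η → η ≤ 1 →
      ∑ R ∈ (idealsLE ⌊A * (1 + η)⌋₊).filter (fun R => A < (Ideal.absNorm R : ℝ)),
        ((Ideal.absNorm R : ℕ) : ℝ)⁻¹ ≤ gamma₀ * η + Cw * A ^ (-(1 / 3 : ℝ)))
    {X η E : ℝ} (hX2 : 2 ≤ X) (hη0 : 0 ≤ η) (hη1 : η ≤ 1) (hE0 : 0 < E) (hEle : E ≤ X ^ (3 / 2 : ℝ))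
    (hXη : X ^ (-(1 / 2 : ℝ)) ≤ η) (Rset : Finset (Ideal (𝓞 K))) :
    ∑ R ∈ Rset.filter (fun R => R ≠ ⊥),
        (if E ∈ Set.Ioc (3 * X ^ 3 / (Ideal.absNorm R : ℝ)) (3 * X ^ 3 / (Ideal.absNorm R : ℝ) * (1 + η))
          then 3 * X ^ 3 / (Ideal.absNorm R : ℝ) else 0) ≤ 3 * X ^ 3 * ((gamma₀ + Cw) * η) := by
  have hX0 : 0 < X := by linarith
  have hX1 : 1 ≤ X := by linarith
  set A : ℝ := 3 * X ^ 3 / E with hA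
  -- `A ≥ 3X^{3/2} ≥ 1` and `A^{-1/3} ≤ X^{-1/2} ≤ η`
  have hX32 : 0 < X ^ (3 / 2 : ℝ) := Real.rpow_pos_of_pos hX0 _
  have hX3 : X ^ 3 = X ^ (3 / 2 : ℝ) * X ^ (3 / 2 : ℝ) := by
    rw [← Real.rpow_add hX0]; norm_num
  have hAge : X ^ (3 / 2 : ℝ) ≤ A := by
    rw [hA, le_div_iff₀ hE0, hX3]
    calc X ^ (3 / 2 : ℝ) * E ≤ X ^ (3 / 2 : ℝ) * X ^ (3 / 2 : ℝ) := mul_le_mul_of_nonneg_left hEle hX32.le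
      _ ≤ 3 * (X ^ (3 / 2 : ℝ) * X ^ (3 / 2 : ℝ)) := by nlinarith [mul_pos hX32 hX32]
  have hX32ge : 1 ≤ X ^ (3 / 2 : ℝ) := Real.one_le_rpow hX1 (by norm_num)
  have hA1 : 1 ≤ A := hX32ge.trans hAge
  have hA0 : 0 < A := by linarith
  have hAinv : A ^ (-(1 / 3 : ℝ)) ≤ η := by
    calc A ^ (-(1 / 3 : ℝ)) ≤ (X ^ (3 / 2 : ℝ)) ^ (-(1 / 3 : ℝ)) :=
          Real.rpow_le_rpow_of_nonpos hX32 hAge (by norm_num)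
      _ = X ^ (-(1 / 2 : ℝ)) := by rw [← Real.rpow_mul hX0.le]; norm_num
      _ ≤ η := hXη
  calc _ ≤ 3 * X ^ 3 * ∑ R ∈ (idealsLE ⌊A * (1 + η)⌋₊).filter (fun R => A < (Ideal.absNorm R : ℝ)),
        ((Ideal.absNorm R : ℕ) : ℝ)⁻¹ := sum_exceptional_le hX0 hE0 Rset
    _ ≤ 3 * X ^ 3 * (gamma₀ * η + Cw * A ^ (-(1 / 3 : ℝ))) :=
        mul_le_mul_of_nonneg_left (hWin A η hA1 hη0 hη1) (by positivity)
    _ ≤ 3 * X ^ 3 * ((gamma₀ + Cw) * η) := by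
        refine mul_le_mul_of_nonneg_left ?_ (by positivity)
        have := mul_le_mul_of_nonneg_left hAinv hCw.le
        linarith

set_option maxHeartbeats 400000 in
/-- **Display (10.5) of Heath-Brown's proof of Lemma 3.9, from Lemma 4.10** — here with the Lemma-4.10 statement
for the boxes `∏ J(m_i)` (`primeTuples_sub_wMeas_le`) as the hypothesis `h410`, so that the argument of pp. 64–66 is
isolated: "`U(ℬ) = 3ηX³Σ₃ + O((X³/M)(η² + exp{−c(log L)^{1/2}})) = 3ηX³Σ₃ + O(η²M⁻¹X³)`, by (2.1)" for `n ≥ 1`, and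
for `n = 0` "`U(ℬ) = ∑_R c_R (3ηX³/(Mξ log X N(R))) w'(3X³/N(R)) + O(η²X³M⁻¹)`". Rendered exactly as the hypothesis
`h5` of `HeathBrown2001_lemma_3_9_of_displays`: for `0 < ϖ < 1/5` there are `C, X₀` with, for `X ≥ X₀`,
`exp(−(log X)^{1/3}) ≤ η ≤ 1`, every `𝐦` satisfying (3.5)–(3.7) (`τ = (log log X)^{−ϖ}`) and every `c_R` as in (3.3),
`|U(ℬ) − 3ηX³Σ₃| ≤ C M⁻¹η²X³` (`C = 2 + 6(γ₀ + C_w)`). Proof: `abs_bilinB_sub_main_le_of_perR` with the per-`R`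
bounds `abs_windowDiff_sub_le_of_two` / `_of_one` (`A = C₄(n+1)(c₁+ξ log X)^n exp(−c₂√(τ log X))`), then
`term1_le` (`≤ M⁻¹η²X³`), and `6η²X³(∑1/N(R))/(MΛ²) ≤ M⁻¹η²X³` (`n ≥ 1`, as `24C_H log X ≤ Λ²`) resp.
`sum_exceptional_le_eta` twice (`n = 0`, `≤ 6(γ₀ + C_w)M⁻¹η²X³`), for `X` beyond the threshold of
`eventually_leadingB_params`. [cite: HeathBrownActa2001, §10 (10.5)] -/
theorem display_10_5_of_tuples
    (h410 : ∃ c₁ c₂ C : ℝ, 0 ≤ c₁ ∧ 0 < c₂ ∧ 0 ≤ C ∧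
      ∀ (X τ : ℝ), 1 < X → 0 < τ → τ ≤ 1 → 3 ≤ X ^ τ →
      ∀ (n : ℕ) (m : Fin (n + 1) → ℕ), CoreAdmissible τ m → ∀ Y : ℝ, 0 < Y →
        |(∑ P ∈ Fintype.piFinset fun i => Jprimes X τ (m i),
            if ∏ i, (Ideal.absNorm (P i) : ℝ) ≤ Y then ∏ i, Real.log (Ideal.absNorm (P i)) else 0) -
          wMeas X τ m Y| ≤
        C * ((n : ℝ) + 1) * Y * (c₁ + hbXi τ * Real.log X) ^ n *
          Real.exp (-c₂ * Real.sqrt (τ * Real.log X))) :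
    ∀ ϖ : ℝ, 0 < ϖ → ϖ < 1 / 5 →
      ∃ C X₀ : ℝ, ∀ X η : ℝ, X₀ ≤ X → Real.exp (-Real.log X ^ (1 / 3 : ℝ)) ≤ η → η ≤ 1 →
        ∀ (k : ℕ) (m : Fin k → ℕ), CoreAdmissible (hbTau ϖ X) m →
          ∀ cR : Ideal (𝓞 K) → ℝ, CSupport X (hbTau ϖ X) cR →
            |bilin (normWindow X η) (fun J => J) cR (dWeight X (hbTau ϖ X) m) -
                3 * η * X ^ 3 * sigma3 X (hbTau ϖ X) m cR| ≤
              C * (∏ i, (m i : ℝ))⁻¹ * η ^ 2 * X ^ 3 := by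
  classical
  intro ϖ hϖ0 hϖ5
  have hϖ1 : ϖ ≤ 1 := by linarith
  obtain ⟨c₁, c₂, C₄, hc₁, hc₂, hC₄, hT⟩ := h410
  obtain ⟨CH, hCH, hH⟩ := exists_sum_inv_absNorm_idealsLE_le
  obtain ⟨Cw, hCw, hWin⟩ := exists_sum_inv_absNorm_window_le
  have hγ := gamma₀_pos
  have hK₀0 : 0 < 100 * (C₄ + 1) * CH := by positivity
  obtain ⟨X₀, hX₀⟩ := Filter.eventually_atTop.mp
    (eventually_leadingB_params hϖ0 hϖ1 (3 / 2 * (c₁ + 1)) (36 * CH) hc₂ hK₀0)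
  refine ⟨2 + 6 * (gamma₀ + Cw), X₀, fun X η hX hη1 hη2 k m hm cR hc => ?_⟩
  obtain ⟨hX2, hL8, hτ0, hτ1, hXτ, hΛ1, hB₁', hB₂', hK₀', hXhalf⟩ := hX₀ X hX
  set τ := hbTau ϖ X with hτdef
  -- basic facts
  have hX1 : 1 < X := by linarith
  have hX0 : 0 < X := by linarith
  have hL0 : 0 < Real.log X := by linarith
  have hξ0 : 0 < hbXi τ := hbXi_pos hτ0
  have hΛ0 : 0 < hbXi τ * Real.log X := by positivity
  have hη0 : 0 < η := (Real.exp_pos _).trans_le hη1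
  have hηsq : Real.exp (-2 * Real.log X ^ (1 / 3 : ℝ)) ≤ η ^ 2 := by
    have : Real.exp (-2 * Real.log X ^ (1 / 3 : ℝ)) = Real.exp (-Real.log X ^ (1 / 3 : ℝ)) ^ 2 := by
      rw [← Real.exp_nat_mul]; ring_nf
    rw [this]
    exact pow_le_pow_left₀ (Real.exp_pos _).le hη1 2
  have hXη : X ^ (-(1 / 2 : ℝ)) ≤ η := hXhalf.trans hη1
  have hK : 100 * (C₄ + 1) * CH * Real.log X * Real.exp (-c₂ * Real.sqrt (τ * Real.log X)) ≤ η ^ 2 :=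
    hK₀'.trans hηsq
  have hk := length_pos_of_coreAdmissible hτ0 hm
  obtain ⟨n, rfl⟩ : ∃ n, k = n + 1 := ⟨k - 1, by omega⟩
  set M : ℝ := ∏ i, (m i : ℝ) with hMdef
  have hM1 : 1 ≤ M := one_le_prod_of_coreAdmissible hτ0 hτ1 hm
  have hM0 : 0 < M := by linarith
  have hD : (∏ i, ((m i : ℝ) * hbXi τ * Real.log X)) = M * (hbXi τ * Real.log X) ^ (n + 1) := by
    rw [hMdef, prod_mul_distrib, prod_mul_distrib, prod_const, prod_const, card_univ, Fintype.card_fin]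
    ring
  have hkτ : ((n : ℝ) + 1) * τ < 3 / 2 := by
    have := card_mul_lt_of_coreAdmissible hτ0 hm
    push_cast at this
    linarith
  have hΛτ : hbXi τ * Real.log X = τ ^ 5 * Real.log X := by rw [hbXi]
  have hnΛ : (n : ℝ) + 1 ≤ hbXi τ * Real.log X ∧ (n : ℝ) * c₁ ≤ hbXi τ * Real.log X := by
    have key : ((n : ℝ) + 1) * (c₁ + 1) ≤ hbXi τ * Real.log X := by
      rw [hΛτ]
      have h1 : ((n : ℝ) + 1) * (c₁ + 1) * τ ≤ 3 / 2 * (c₁ + 1) := by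
        calc ((n : ℝ) + 1) * (c₁ + 1) * τ = ((n : ℝ) + 1) * τ * (c₁ + 1) := by ring
          _ ≤ 3 / 2 * (c₁ + 1) := mul_le_mul_of_nonneg_right hkτ.le (by linarith)
      refine le_of_mul_le_mul_right ?_ hτ0
      calc ((n : ℝ) + 1) * (c₁ + 1) * τ ≤ 3 / 2 * (c₁ + 1) := h1
        _ ≤ τ ^ 6 * Real.log X := hB₁'
        _ = τ ^ 5 * Real.log X * τ := by ring
    have hn0 : (0 : ℝ) ≤ n := Nat.cast_nonneg n
    constructor
    · calc (n : ℝ) + 1 = ((n : ℝ) + 1) * 1 := (mul_one _).symm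
        _ ≤ ((n : ℝ) + 1) * (c₁ + 1) := mul_le_mul_of_nonneg_left (by linarith) (by linarith)
        _ ≤ _ := key
    · calc (n : ℝ) * c₁ ≤ (n : ℝ) * c₁ + ((n : ℝ) + c₁ + 1) := le_add_of_nonneg_right (by linarith)
        _ = ((n : ℝ) + 1) * (c₁ + 1) := by ring
        _ ≤ _ := key
  set ε₄ : ℝ := Real.exp (-c₂ * Real.sqrt (τ * Real.log X)) with hε₄
  have hε₄0 : 0 < ε₄ := Real.exp_pos _
  set A : ℝ := C₄ * ((n : ℝ) + 1) * (c₁ + hbXi τ * Real.log X) ^ n * ε₄ with hAdef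
  have hTA : ∀ Z, 0 < Z → |(∑ P ∈ Fintype.piFinset fun i => Jprimes X τ (m i),
      if ∏ i, (Ideal.absNorm (P i) : ℝ) ≤ Z then ∏ i, Real.log (Ideal.absNorm (P i)) else 0) -
        wMeas X τ m Z| ≤ A * Z := by
    intro Z hZ
    refine (hT X τ hX1 hτ0 hτ1 hXτ n m hm Z hZ).trans (le_of_eq ?_)
    simp only [hAdef]
    ring
  -- the set of `R ≠ 0`, the harmonic sum and its bound
  set S := (idealsLE ⌊3 * X ^ 3 * (1 + η)⌋₊).filter (fun R => R ≠ ⊥) with hS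
  have hY : ∀ R ∈ S, 0 < 3 * X ^ 3 / (Ideal.absNorm R : ℝ) := by
    intro R hR
    obtain ⟨-, hR0⟩ := mem_filter.mp hR
    have : Ideal.absNorm R ≠ 0 := fun h => hR0 (Ideal.absNorm_eq_zero_iff.mp h)
    positivity
  set Hs : ℝ := ∑ R ∈ S, ((Ideal.absNorm R : ℕ) : ℝ)⁻¹ with hHs
  have hHs0 : 0 ≤ Hs := sum_nonneg fun R _ => by positivity
  have hHsle : Hs ≤ 4 * CH * Real.log X := by
    have hN1 : 1 ≤ ⌊3 * X ^ 3 * (1 + η)⌋₊ := by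
      refine (Nat.one_le_floor_iff _).mpr ?_
      have h8 : (2 : ℝ) ^ 3 ≤ X ^ 3 := pow_le_pow_left₀ (by norm_num) hX2 3
      have h1η : (1 : ℝ) ≤ 1 + η := by linarith
      calc (1 : ℝ) ≤ 3 * 2 ^ 3 * 1 := by norm_num
        _ ≤ 3 * X ^ 3 * (1 + η) := by gcongr
    have h := hH _ hN1
    have hfl : (⌊3 * X ^ 3 * (1 + η)⌋₊ : ℝ) ≤ 6 * X ^ 3 := by
      refine (Nat.floor_le (by positivity)).trans ?_
      calc 3 * X ^ 3 * (1 + η) ≤ 3 * X ^ 3 * 2 := by gcongr; linarith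
        _ = 6 * X ^ 3 := by ring
    have hlogN : Real.log (⌊3 * X ^ 3 * (1 + η)⌋₊ : ℝ) ≤ 2 + 3 * Real.log X := by
      calc Real.log (⌊3 * X ^ 3 * (1 + η)⌋₊ : ℝ) ≤ Real.log (6 * X ^ 3) :=
            Real.log_le_log (by exact_mod_cast Nat.lt_of_lt_of_le Nat.zero_lt_one hN1) hfl
        _ = Real.log 6 + 3 * Real.log X := by
            rw [Real.log_mul (by norm_num) (by positivity), Real.log_pow]; push_cast; ring
        _ ≤ 2 + 3 * Real.log X := by linarith [log_six_le_two]
    calc Hs ≤ CH * (1 + Real.log (⌊3 * X ^ 3 * (1 + η)⌋₊ : ℝ)) := h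
      _ ≤ CH * (1 + (2 + 3 * Real.log X)) := by gcongr
      _ = 4 * CH * Real.log X - CH * (Real.log X - 3) := by ring
      _ ≤ 4 * CH * Real.log X := by
          have : 0 ≤ CH * (Real.log X - 3) := mul_nonneg hCH.le (by linarith)
          linarith
  -- Term 1: the Lemma 4.10 errors
  have hT1 : (M * (hbXi τ * Real.log X) ^ (n + 1))⁻¹ * (3 * A * (3 * X ^ 3 * Hs)) ≤ M⁻¹ * η ^ 2 * X ^ 3 :=
    term1_le hM0 hΛ0 hc₁ hC₄ hCH hε₄0 hX0 hHs0 hHsle hnΛ.1 hnΛ.2 hK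
  have hMηX : 0 ≤ M⁻¹ * η ^ 2 * X ^ 3 := by positivity
  -- the two cases `n = 0` and `n ≥ 1`
  rcases n with _ | n'
  · -- `k = 1`: the exceptional endpoints
    have hper := fun R (hR : R ∈ S) =>
      abs_windowDiff_sub_le_of_one hX1.le hτ0.le m hTA (hY R hR) hη0.le hη2
    have hmain := abs_bilinB_sub_main_le_of_perR hX1.le hτ0 hη0.le m hc hper
    refine hmain.trans ?_
    rw [hD]
    -- the two endpoints
    set E₁ : ℝ := X ^ ((m 0 : ℝ) * hbXi τ) with hE₁
    set E₂ : ℝ := X ^ (((m 0 : ℝ) + 1) * hbXi τ) with hE₂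
    have hE₁0 : 0 < E₁ := Real.rpow_pos_of_pos hX0 _
    have hE₂0 : 0 < E₂ := Real.rpow_pos_of_pos hX0 _
    have hE₂le : E₂ ≤ X ^ (3 / 2 : ℝ) := by
      have h := (rpow_bounds_of_coreAdmissible hX1.le hτ0 hm).2
      rw [Fin.sum_univ_one] at h
      calc E₂ = X ^ (hbXi τ * ((m 0 : ℝ) + 1)) := by rw [hE₂, mul_comm]
        _ ≤ X ^ (3 / 2 - τ) := h
        _ ≤ X ^ (3 / 2 : ℝ) := Real.rpow_le_rpow_of_exponent_le hX1.le (by linarith)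
    have hE₁le : E₁ ≤ X ^ (3 / 2 : ℝ) := by
      refine le_trans ?_ hE₂le
      exact Real.rpow_le_rpow_of_exponent_le hX1.le (by nlinarith)
    have hexc₁ := sum_exceptional_le_eta hCw hWin hX2 hη0.le hη2 hE₁0 hE₁le hXη (idealsLE ⌊3 * X ^ 3 * (1 + η)⌋₊)
    have hexc₂ := sum_exceptional_le_eta hCw hWin hX2 hη0.le hη2 hE₂0 hE₂le hXη (idealsLE ⌊3 * X ^ 3 * (1 + η)⌋₊)
    -- `∑ MV ≤ 6(γ₀ + Cw) η² X³`
    have hMV : ∑ R ∈ S, (if E₁ ∈ Set.Ioc (3 * X ^ 3 / (Ideal.absNorm R : ℝ)) (3 * X ^ 3 / (Ideal.absNorm R : ℝ) * (1 + η)) ∨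
          E₂ ∈ Set.Ioc (3 * X ^ 3 / (Ideal.absNorm R : ℝ)) (3 * X ^ 3 / (Ideal.absNorm R : ℝ) * (1 + η))
        then η * (3 * X ^ 3 / (Ideal.absNorm R : ℝ)) else 0) ≤ 6 * (gamma₀ + Cw) * η ^ 2 * X ^ 3 := by
      have hsplit : ∀ R ∈ S, (if E₁ ∈ Set.Ioc (3 * X ^ 3 / (Ideal.absNorm R : ℝ)) (3 * X ^ 3 / (Ideal.absNorm R : ℝ) * (1 + η)) ∨
            E₂ ∈ Set.Ioc (3 * X ^ 3 / (Ideal.absNorm R : ℝ)) (3 * X ^ 3 / (Ideal.absNorm R : ℝ) * (1 + η))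
          then η * (3 * X ^ 3 / (Ideal.absNorm R : ℝ)) else 0) ≤
          η * (if E₁ ∈ Set.Ioc (3 * X ^ 3 / (Ideal.absNorm R : ℝ)) (3 * X ^ 3 / (Ideal.absNorm R : ℝ) * (1 + η))
            then 3 * X ^ 3 / (Ideal.absNorm R : ℝ) else 0) +
          η * (if E₂ ∈ Set.Ioc (3 * X ^ 3 / (Ideal.absNorm R : ℝ)) (3 * X ^ 3 / (Ideal.absNorm R : ℝ) * (1 + η))
            then 3 * X ^ 3 / (Ideal.absNorm R : ℝ) else 0) :=
        fun R hR => ite_or_mul_le hη0.le (hY R hR).le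
      refine (sum_le_sum hsplit).trans ?_
      rw [sum_add_distrib, ← mul_sum, ← mul_sum]
      calc η * _ + η * _ ≤ η * (3 * X ^ 3 * ((gamma₀ + Cw) * η)) + η * (3 * X ^ 3 * ((gamma₀ + Cw) * η)) :=
            add_le_add (mul_le_mul_of_nonneg_left hexc₁ hη0.le) (mul_le_mul_of_nonneg_left hexc₂ hη0.le)
        _ = 6 * (gamma₀ + Cw) * η ^ 2 * X ^ 3 := by ring
    -- Term 3
    have hT3 : (M * (hbXi τ * Real.log X) ^ (0 + 1))⁻¹ * (6 * (gamma₀ + Cw) * η ^ 2 * X ^ 3) ≤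
        6 * (gamma₀ + Cw) * (M⁻¹ * η ^ 2 * X ^ 3) := by
      rw [zero_add, pow_one, mul_inv]
      have hΛinv : (hbXi τ * Real.log X)⁻¹ ≤ 1 := inv_le_one_of_one_le₀ hΛ1
      have h0 : 0 ≤ M⁻¹ * (6 * (gamma₀ + Cw) * η ^ 2 * X ^ 3) := by positivity
      calc M⁻¹ * (hbXi τ * Real.log X)⁻¹ * (6 * (gamma₀ + Cw) * η ^ 2 * X ^ 3)
          = (hbXi τ * Real.log X)⁻¹ * (M⁻¹ * (6 * (gamma₀ + Cw) * η ^ 2 * X ^ 3)) := by ring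
        _ ≤ 1 * (M⁻¹ * (6 * (gamma₀ + Cw) * η ^ 2 * X ^ 3)) := mul_le_mul_of_nonneg_right hΛinv h0
        _ = 6 * (gamma₀ + Cw) * (M⁻¹ * η ^ 2 * X ^ 3) := by ring
    rw [mul_add]
    calc _ ≤ M⁻¹ * η ^ 2 * X ^ 3 + 6 * (gamma₀ + Cw) * (M⁻¹ * η ^ 2 * X ^ 3) :=
          add_le_add hT1 ((mul_le_mul_of_nonneg_left hMV (by positivity)).trans hT3)
      _ = (1 + 6 * (gamma₀ + Cw)) * (M⁻¹ * η ^ 2 * X ^ 3) := by ring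
      _ ≤ (2 + 6 * (gamma₀ + Cw)) * (M⁻¹ * η ^ 2 * X ^ 3) :=
          mul_le_mul_of_nonneg_right (by linarith) hMηX
      _ = (2 + 6 * (gamma₀ + Cw)) * M⁻¹ * η ^ 2 * X ^ 3 := by ring
  · -- `k ≥ 2`: the mean value theorem and (8.3)
    have hper := fun R (hR : R ∈ S) =>
      abs_windowDiff_sub_le_of_two hX1.le hτ0.le m hTA (hY R hR) hη0.le hη2
    have hmain := abs_bilinB_sub_main_le_of_perR hX1.le hτ0 hη0.le m hc hper
    refine hmain.trans ?_
    rw [hD]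
    have hMV : ∑ R ∈ S, 2 * η ^ 2 * (3 * X ^ 3 / (Ideal.absNorm R : ℝ)) * (hbXi τ * Real.log X) ^ n' =
        2 * η ^ 2 * (hbXi τ * Real.log X) ^ n' * (3 * X ^ 3 * Hs) := by
      rw [hHs, mul_sum, mul_sum]
      refine sum_congr rfl fun R _ => ?_
      rw [div_eq_mul_inv]; ring
    rw [hMV]
    -- Term 2
    have hT2 : (M * (hbXi τ * Real.log X) ^ (n' + 1 + 1))⁻¹ *
        (2 * η ^ 2 * (hbXi τ * Real.log X) ^ n' * (3 * X ^ 3 * Hs)) ≤ M⁻¹ * η ^ 2 * X ^ 3 := by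
      set Λ := hbXi τ * Real.log X with hΛ
      have hΛn : 0 < Λ ^ n' := pow_pos hΛ0 _
      calc (M * Λ ^ (n' + 1 + 1))⁻¹ * (2 * η ^ 2 * Λ ^ n' * (3 * X ^ 3 * Hs))
          = M⁻¹ * η ^ 2 * X ^ 3 * (6 * Hs / Λ ^ 2) * (Λ ^ n' * (Λ ^ n')⁻¹) := by
            field_simp; ring
        _ = M⁻¹ * η ^ 2 * X ^ 3 * (6 * Hs / Λ ^ 2) := by rw [mul_inv_cancel₀ hΛn.ne', mul_one]
        _ ≤ M⁻¹ * η ^ 2 * X ^ 3 * 1 := by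
            refine mul_le_mul_of_nonneg_left ?_ hMηX
            rw [div_le_one (pow_pos hΛ0 2)]
            calc 6 * Hs ≤ 6 * (4 * CH * Real.log X) := by linarith
              _ ≤ 36 * CH * Real.log X := by have := mul_pos hCH hL0; linarith
              _ ≤ Λ ^ 2 := hB₂'
        _ = M⁻¹ * η ^ 2 * X ^ 3 := mul_one _
    rw [mul_add]
    calc _ ≤ M⁻¹ * η ^ 2 * X ^ 3 + M⁻¹ * η ^ 2 * X ^ 3 := add_le_add hT1 hT2
      _ = 2 * (M⁻¹ * η ^ 2 * X ^ 3) := by ring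
      _ ≤ (2 + 6 * (gamma₀ + Cw)) * (M⁻¹ * η ^ 2 * X ^ 3) :=
          mul_le_mul_of_nonneg_right (le_add_of_nonneg_right (by positivity)) hMηX
      _ = (2 + 6 * (gamma₀ + Cw)) * M⁻¹ * η ^ 2 * X ^ 3 := by ring

/-- **Display (10.5) of Heath-Brown's proof of Lemma 3.9** (p. 65), PROVED:
"`U(ℬ) = 3ηX³Σ₃ + O(η²M⁻¹X³)`" for every bilinear sum (3.3) over `ℬ^(K)` with weight `d_S(𝐦)` — in the standing
set-up (`τ = (log log X)^{−ϖ}`, `0 < ϖ < 1/5`, `ξ = τ⁵`, `η` in (2.1), `X` large, `𝐦` satisfying (3.5)–(3.7) of any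
length `n + 1 ≥ 1`, `c_R` as in (3.3)), from Lemma 4.10 (`HeathBrownCubicPrimeTuples`, itself from the degree-one
prime number theorem), the `w`-calculus (`HeathBrownCubicWCalculus`) and Weber's ideal count (Lemma 4.1). This is the
hypothesis `h5` of `HeathBrown2001_lemma_3_9_of_displays`. [cite: HeathBrownActa2001, §10 (10.5)] -/
theorem HeathBrown2001_display_10_5 :
    ∀ ϖ : ℝ, 0 < ϖ → ϖ < 1 / 5 →
      ∃ C X₀ : ℝ, ∀ X η : ℝ, X₀ ≤ X → Real.exp (-Real.log X ^ (1 / 3 : ℝ)) ≤ η → η ≤ 1 →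
        ∀ (k : ℕ) (m : Fin k → ℕ), CoreAdmissible (hbTau ϖ X) m →
          ∀ cR : Ideal (𝓞 K) → ℝ, CSupport X (hbTau ϖ X) cR →
            |bilin (normWindow X η) (fun J => J) cR (dWeight X (hbTau ϖ X) m) -
                3 * η * X ^ 3 * sigma3 X (hbTau ϖ X) m cR| ≤
              C * (∏ i, (m i : ℝ))⁻¹ * η ^ 2 * X ^ 3 :=
  display_10_5_of_tuples primeTuples_sub_wMeas_le

/-- **Heath-Brown's Lemma 3.9 from display (10.4) alone**: with (10.5) proved, the named fact
`HeathBrown2001_lemma_3_9` follows from the `𝒜`-side display (10.4) ("`U_e(𝒜) = σ₀η²X²Σ₃ + O(M⁻¹η^{5/2}X²(log X)^c)`",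
p. 64 — Lemma 3.2, (10.1)–(10.2), the evaluation of `Σ₁`), which remains the hypothesis `h4`.
[cite: HeathBrownActa2001, Lemma 3.9 and §10 (10.4)] -/
theorem HeathBrown2001_lemma_3_9_of_display_10_4
    (h4 : ∀ σ₀ : ℝ, Tendsto singularProductPartial atTop (𝓝 σ₀) →
      ∀ ϖ : ℝ, 0 < ϖ → ϖ < 1 / 5 →
        ∃ c C X₀ : ℝ, ∀ X η : ℝ, X₀ ≤ X → Real.exp (-Real.log X ^ (1 / 3 : ℝ)) ≤ η → η ≤ 1 →
          ∀ (k : ℕ) (m : Fin k → ℕ), CoreAdmissible (hbTau ϖ X) m →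
            ∀ cR : Ideal (𝓞 K) → ℝ, CSupport X (hbTau ϖ X) cR →
              |bilin (boxPairs X η) pairIdeal cR (eWeight X (hbTau ϖ X) m) -
                  σ₀ * η ^ 2 * X ^ 2 * sigma3 X (hbTau ϖ X) m cR| ≤
                C * (∏ i, (m i : ℝ))⁻¹ * η ^ (5 / 2 : ℝ) * X ^ 2 * Real.log X ^ c) :
    HeathBrown2001_lemma_3_9 :=
  HeathBrown2001_lemma_3_9_of_displays h4 HeathBrown2001_display_10_5

end Assembly

end Literature.NumberTheory.Sieve.CubicSieve

end
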